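import Literature.Analysis.FluidPDE.NSBootstrapHigherHolder
import Literature.Analysis.FluidPDE.CKNLocalRegularityRRSPressure
import Literature.Analysis.FluidPDE.DistributionalPressurePoisson
import Literature.Analysis.FluidPDE.PineauVicolOneSliceProofs
import Literature.Analysis.FluidPDE.NSBootstrapContinuousRep
import Literature.Analysis.FluidPDE.ClassicalSuitableRegion
import Literature.Analysis.FluidPDE.ClassicalSolutionRegionRescale
import Literature.Analysis.FluidPDE.SuitableWeakPressure
import Literature.Analysis.FluidPDE.LocalTypeIScaling
import Literature.Analysis.FluidPDE.LeraySelfSimilarCalculus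
import Mathlib.Analysis.SpecialFunctions.JapaneseBracket
import Mathlib.Analysis.SpecialFunctions.Pow.Integral
import HarnessLib

/-!
# Pineau–Vicol 2026, Theorem 1.9 — the printed proof: Lemma 9.2 (Type I bounds for `∇u`)
  near the vertex, with a constant depending on `C_u` only

Analysis/FluidPDE proof file, sixth sibling of `PineauVicolOneSlice.lean` (the named fact
`Literature.Analysis.FluidPDE.pineauVicol2026_oneSlice_regularity`, B. Pineau, V. Vicol,
arXiv:2607.09619 (2026), Thm. 1.9). Lemma 9.2 of the paper (p. 30): under the Type I bound
(1.15) on `Q°₁`, `|∇ᵏu(x, t)| ≤ C_{k,ε} ((−t)^{(k+1)/2} + |x|^{k+1})⁻¹` on `Q°_{1−ε}`, with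
`C_{k,ε}` depending only on `k, ε, C_u`; its proof rescales the cylinder `Q_{2ρ}(x, t)`,
`ρ = c(|x| + √(−t))`, on which `|u| ≤ C_u/ρ` by (1.15), to unit size and applies the
**pressure-free** quantitative interior estimate of Lemma 9.1 (Serrin 1962 [59];
Chen–Strain–Tsai–Yau [16, Lemma A.2]). What Theorem 1.9 uses downstream (Lemma 9.4, (9.15),
§9.3) is the case `k ≤ 1` at points near the vertex `(0, 0)` and at small scales, with the
crucial feature that the constant depends on `C_u` only (it enters `R_*`, `R_{**}` and hence
`δ₀ = δ₀(C_u)`).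

**Deviation from the printed proof (same statement where it is used).** The tree has no
pressure-free interior regularity, but it has the quantitative higher regularity of bounded
distributional solutions *with* an `L^{3/2}` pressure (`NSBootstrap.exists_smooth_holder_rep_norm`,
Seregin–Šverák 2009 §2 / Lemarié-Rieusset 2016 Thm. 13.1 / Serrin 1962, proved), the local
pressure estimate of Robinson–Rodrigo–Sadowski, Lemma 15.12 (`RRS2016.lemma15_12_holds`,
proved), and the pressure class of the solutions of Theorem 1.9
(`PineauVicolOneSlicePressure`: `∫∫_{(−1,0)×B_{1/32}} |p|^{3/2} ≤ B_p(C_u, C_p)`). We therefore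
prove Lemma 9.2 for `k = 1` in the following form, sufficient for Theorem 1.9: **for every `C_u`
there is `K = K(C_u)` such that for all finite `B_u, B_p` there is `c₁ = c₁(C_u, B_u, B_p) > 0`
with `|∇u(x, t)| ≤ K (|x| + √(−t))⁻²` whenever `|x| + √(−t) ≤ c₁`**, for every classical
solution on `[−1,0) × B₁` with (1.15), `∫∫|u|³ ≤ B_u` on `(−1,0) × B₁` and
`∫∫|p|^{3/2} ≤ B_p` on `(−1,0) × B_{1/32}` (`exists_forall_fderiv_le_of_typeI_of_bounds`). The
point is that the pressure enters the Serrin estimate only through the scale-invariant mean-free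
quantity `ρ⁻² ∫∫_{Q_ρ} |p − (p)_{B_ρ}(t)|^{3/2}`, which by RRS Lemma 15.12 (on `Q((t,x), 1/64)`
with inner radius `ρ`) is `≤ C(C_u) + C ρ^{5/2} (B_u + B_p)`: the near term because
`|u| ≤ C_u/ρ` on `Q((t,x), 2ρ)`, the far term because `|u(t', y)| ≤ C_u/|y|` and
`∫_{|y−x|>2ρ} |y|⁻²|y−x|⁻⁴ dy ≤ G ρ⁻³` uniformly in `x` — so at scales `ρ ≤ ρ₁(C_u, B_u, B_p)` the
Serrin constant depends on `C_u` alone. Since `s₀` in Theorem 1.9 may depend on `(C_u, C_p)`,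
restricting to small scales costs nothing.

Contents: `IsDistributionalNSSolutionOn.sub_timeFun` (the pressure is determined up to a
function of time), `exists_forall_fderiv_le_of_bounded` (quantitative Serrin gradient bound for
classical solutions on `Q(z, c)` with `|u| ≤ A/c` and `c⁻²∫∫|p − h(t)|^{3/2} ≤ P`: parabolic zoom
+ pressure shift + the tree's bootstrap, whose representative agrees with the continuous `u`),
the far-field weight (`exists_farField_unit_bound`, `exists_farField_bound`), the pressure
oscillation decay `lintegral_pressure_osc_le`, and the assembly
`exists_forall_fderiv_le_of_typeI`, `exists_forall_fderiv_le_of_typeI_of_bounds`.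

## References

* B. Pineau, V. Vicol, arXiv:2607.09619 (2026), Lemmas 9.1–9.2 and their proofs (p. 30).
  [PineauVicol2026]
* J. Serrin, Arch. Rational Mech. Anal. 9 (1962) 187–195 (interior regularity). [Serrin1962]
* G. Seregin, V. Šverák, Comm. PDE 34 (2009), §2 p. 8 (quantitative higher regularity).
  [SereginSverak2009]
* J. C. Robinson, J. L. Rodrigo, W. Sadowski, *The Three-Dimensional Navier–Stokes Equations*
  (2016), Lemma 15.12. [RobinsonRodrigoSadowski2016]
* L. Caffarelli, R. Kohn, L. Nirenberg, CPAM 35 (1982), §2 (the pressure is determined up to a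
  function of time; scaling). [CaffarelliKohnNirenberg1982]
-/

noncomputable section

open MeasureTheory Set Function Filter Metric TopologicalSpace
open _root_.Topology
open scoped ENNReal NNReal InnerProductSpace RealInnerProductSpace Laplacian

namespace Literature.Analysis.FluidPDE

section PressureShift

variable {E : Type*} [NormedAddCommGroup E] [InnerProductSpace ℝ E] [FiniteDimensional ℝ E]
  [MeasurableSpace E] [BorelSpace E]

/-- **The pressure of a distributional solution is determined only up to a function of time**:
if `(u, p)` solves the Navier–Stokes system in the sense of distributions on the open region
`Q` and `(t, x) ↦ c(t)` is locally integrable on `Q`, then so does `(u, p − c)` (the extra term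
of the momentum equation is `∫ c(t) (∫ div ψ(t, ·) dx) dt = 0`; cf. the tree's
`IsSuitableWeakSolutionOn.sub_pressure`). [cite: CaffarelliKohnNirenberg1982, §2] -/
theorem IsDistributionalNSSolutionOn.sub_timeFun {Q : Opens (ℝ × E)} {ν : ℝ} {f u : ℝ → E → E}
    {p : ℝ → E → ℝ} (h : IsDistributionalNSSolutionOn Q ν f u p) {c : ℝ → ℝ}
    (hc : LocallyIntegrableOn (fun z : ℝ × E => c z.1) (Q : Set (ℝ × E)) volume) :
    IsDistributionalNSSolutionOn Q ν f u (fun t x => p t x - c t) := by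
  obtain ⟨hu, hu2, hp, hdiv, hmom⟩ := h
  refine ⟨hu, hu2, ?_, hdiv, fun ψ hψ => ?_⟩
  · have e : uncurry (fun t x => p t x - c t) = uncurry p - fun z : ℝ × E => c z.1 := rfl
    rw [e]
    exact hp.sub hc
  · obtain ⟨hwc, hw0⟩ := hψ.continuous_divergence_field
    have hKc : IsCompact (tsupport (uncurry ψ)) := hψ.hasCompactSupport
    have hKQ : tsupport (uncurry ψ) ⊆ (Q : Set (ℝ × E)) := hψ.tsupport_subset
    have hI : Integrable (fun z : ℝ × E => c z.1 * VectorCalculus.divergence (ψ z.1) z.2)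
        (volume : Measure (ℝ × E)) :=
      integrable_mul_of_locallyIntegrableOn hc hwc hKc hKQ hw0
    have hzero : ∫ z in (Q : Set (ℝ × E)), c z.1 * VectorCalculus.divergence (ψ z.1) z.2 = 0 := by
      have h0 : ∀ z : ℝ × E, z ∉ (Q : Set (ℝ × E)) →
          c z.1 * VectorCalculus.divergence (ψ z.1) z.2 = 0 :=
        fun z hz => by rw [hw0 z fun h' => hz (hKQ h'), mul_zero]
      rw [setIntegral_eq_integral_of_forall_compl_eq_zero h0, Measure.volume_eq_prod,
        integral_prod _ hI]
      have h1 : ∀ t : ℝ, ∫ x, c t * VectorCalculus.divergence (ψ t) x = 0 := by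
        intro t
        rw [integral_const_mul, integral_divergence_eq_zero
          ((hψ.contDiff_slice t).of_le (by
            change ((1 : ℕ∞) : WithTop ℕ∞) ≤ ((⊤ : ℕ∞) : WithTop ℕ∞)
            exact_mod_cast le_top)) (hψ.hasCompactSupport_slice t), mul_zero]
      simp only [h1, integral_zero]
    have key := hmom ψ hψ
    have e : ∀ z : ℝ × E,
        ⟪u z.1 z.2, timeDeriv ψ z.1 z.2⟫ + ⟪u z.1 z.2, convect (u z.1) (ψ z.1) z.2⟫ +
            ν * ⟪u z.1 z.2, Δ (ψ z.1) z.2⟫ +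
            (fun t x => p t x - c t) z.1 z.2 * VectorCalculus.divergence (ψ z.1) z.2 +
            ⟪f z.1 z.2, ψ z.1 z.2⟫ =
          (⟪u z.1 z.2, timeDeriv ψ z.1 z.2⟫ + ⟪u z.1 z.2, convect (u z.1) (ψ z.1) z.2⟫ +
            ν * ⟪u z.1 z.2, Δ (ψ z.1) z.2⟫ +
            p z.1 z.2 * VectorCalculus.divergence (ψ z.1) z.2 + ⟪f z.1 z.2, ψ z.1 z.2⟫) -
          c z.1 * VectorCalculus.divergence (ψ z.1) z.2 := by
      intro z
      simp only
      ring
    simp_rw [e]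
    rw [integral_sub_eq_self_of_integral_eq_zero hI.integrableOn hzero]
    exact key

end PressureShift

section Serrin

-- nested operator types
set_option maxSynthPendingDepth 3

/-- The zoom `Φ(s, y) = (t + c² s, x + c y)` maps `Q(0, 1)` onto `Q((t, x), c)`. [folklore] -/
theorem stAffine_sq_preimage_parabolicCylinder_self {c : ℝ} (hc : 0 < c) (z : ℝ × (EuclideanSpace ℝ (Fin 3))) :
    stAffine (c ^ 2) c z.1 z.2 ⁻¹' parabolicCylinder c z =
      parabolicCylinder 1 (0 : ℝ × (EuclideanSpace ℝ (Fin 3))) := by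
  have h := LocalTypeIScaling.stAffine_preimage_parabolicCylinder hc z.1 z.2 1 0
  have h0 : stAffine (c ^ 2) c z.1 z.2 (0 : ℝ × (EuclideanSpace ℝ (Fin 3))) = z := by
    simp [stAffine]
  rwa [h0, mul_one] at h

/-- The zoom maps `Q(0, r)` into `Q((t, x), c r)`: if `w ∈ Q(z, c r)` then
`Φ⁻¹ w = ((w.1 − t)/c², (w.2 − x)/c) ∈ Q(0, r)`. [folklore] -/
theorem inv_zoom_mem_parabolicCylinder {c r : ℝ} (hc : 0 < c) {z w : ℝ × (EuclideanSpace ℝ (Fin 3))}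
    (hw : w ∈ parabolicCylinder (c * r) z) :
    ((w.1 - z.1) / c ^ 2, c⁻¹ • (w.2 - z.2)) ∈ parabolicCylinder r (0 : ℝ × (EuclideanSpace ℝ (Fin 3))) := by
  rw [mem_parabolicCylinder] at hw ⊢
  obtain ⟨⟨h1, h2⟩, h3⟩ := hw
  have hc2 : 0 < c ^ 2 := by positivity
  refine ⟨⟨?_, ?_⟩, ?_⟩
  · simp only [Prod.fst_zero]
    rw [zero_sub, lt_div_iff₀ hc2]
    nlinarith [mul_pow c r 2]
  · simp only [Prod.fst_zero]
    rw [div_lt_iff₀ hc2]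
    linarith
  · simp only [Prod.snd_zero, dist_zero_right]
    rw [dist_eq_norm] at h3
    rw [norm_smul, norm_inv, Real.norm_of_nonneg hc.le, inv_mul_lt_iff₀ hc]
    linarith

/-- **Serrin-type gradient bound for bounded classical solutions with an `L^{3/2}` pressure,
quantitative.** For every velocity bound `A` and pressure bound `P` there is `K = K(A, P)` such
that: if `(u, p)` is a classical solution (`ν = 1`, `f = 0`) on the open cylinder `Q(z, c)` with
`|u| ≤ A/c` there and `c⁻² ∫∫_{Q(z,c)} |p − h(t)|^{3/2} ≤ P` for some locally integrable
function `h` of time, then `|∇u| ≤ K/c²` on `Q(z, c/2)`. Proof: the parabolic zoom to `Q(0, 1)`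
(`nsRescale_translate_of_isOpen`), the normalisation `p ↦ p − h` of the pressure
(`IsDistributionalNSSolutionOn.sub_timeFun`), and the tree's quantitative higher regularity
of bounded distributional solutions (`NSBootstrap.exists_smooth_holder_rep_norm`: Serrin 1962;
Seregin–Šverák 2009, §2), whose representative agrees with the continuous `u`. This replaces
the pressure-free interior estimate of Pineau–Vicol's Lemma 9.1 (quantitative Serrin,
[59]/[16, Lemma A.2]) in the tree. [cite: PineauVicol2026, Lemma 9.1, arXiv:2607.09619 p. 30] -/
theorem exists_forall_fderiv_le_of_bounded (A : ℝ) (P : ℝ≥0) :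
    ∃ K : ℝ, 0 ≤ K ∧ ∀ (u : ℝ → (EuclideanSpace ℝ (Fin 3)) → (EuclideanSpace ℝ (Fin 3))) (p : ℝ → (EuclideanSpace ℝ (Fin 3)) → ℝ) (h : ℝ → ℝ) (z : ℝ × (EuclideanSpace ℝ (Fin 3))) (c : ℝ),
      0 < c →
      IsClassicalNSSolutionOnRegion (parabolicCylinder c z) 1 0 u p →
      (∀ w ∈ parabolicCylinder c z, ‖u w.1 w.2‖ ≤ A / c) →
      LocallyIntegrableOn (fun w : ℝ × (EuclideanSpace ℝ (Fin 3)) => h w.1) (parabolicCylinder c z) volume →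
      (∫⁻ w in parabolicCylinder c z, ‖p w.1 w.2 - h w.1‖ₑ ^ (3 / 2 : ℝ) ≤
        ENNReal.ofReal (c ^ 2) * P) →
      ∀ w ∈ parabolicCylinder (c / 2) z, ‖fderiv ℝ (u w.1) w.2‖ ≤ K / c ^ 2 := by
  obtain ⟨Kf, Cf, αf, hαf, hnorm⟩ := NSBootstrap.exists_smooth_holder_rep_norm 1 A P
  refine ⟨Kf 1 (1 / 2), (Kf 1 (1 / 2)).coe_nonneg, ?_⟩
  intro u p h z c hc hreg hbd hh hP w hw
  have hc2 : 0 < c ^ 2 := by positivity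
  set Q : Set (ℝ × (EuclideanSpace ℝ (Fin 3))) := parabolicCylinder c z with hQ_def
  have hQo : IsOpen Q := isOpen_parabolicCylinder c z
  set Φ := stAffine (c ^ 2) c z.1 z.2 with hΦ_def
  have hpre : Φ ⁻¹' Q = parabolicCylinder 1 (0 : ℝ × (EuclideanSpace ℝ (Fin 3))) :=
    stAffine_sq_preimage_parabolicCylinder_self hc z
  -- the zoomed classical solution on `Q(0, 1)`
  set v : ℝ → (EuclideanSpace ℝ (Fin 3)) → (EuclideanSpace ℝ (Fin 3)) := c • stPull (c ^ 2) c z.1 z.2 u with hv_def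
  set ph : ℝ → (EuclideanSpace ℝ (Fin 3)) → ℝ := fun t x => p t x - h t with hph_def
  set q : ℝ → (EuclideanSpace ℝ (Fin 3)) → ℝ := c ^ 2 • stPull (c ^ 2) c z.1 z.2 p with hq_def
  set hz : ℝ → ℝ := fun s => c ^ 2 * h (z.1 + c ^ 2 * s) with hhz_def
  have hcl : IsClassicalNSSolutionOnRegion (parabolicCylinder 1 (0 : ℝ × (EuclideanSpace ℝ (Fin 3)))) 1 0 v q := by
    have h1 := hreg.nsRescale_translate_of_isOpen hQo hc z.1 z.2
    have ef : (c ^ 2 * c) • stPull (c ^ 2) c z.1 z.2 (0 : ℝ → (EuclideanSpace ℝ (Fin 3)) → (EuclideanSpace ℝ (Fin 3))) = 0 := by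
      funext s y; simp [stPull_apply]
    rw [ef, hpre] at h1
    exact h1
  have hdist : IsDistributionalNSSolutionOn (parabolicCylinderOpens 1 (0 : ℝ × (EuclideanSpace ℝ (Fin 3)))) 1 0 v
      (fun s y => q s y - hz s) := by
    have hd := hcl.isDistributionalNSSolutionOn (isOpen_parabolicCylinder 1 0)
      (Q := parabolicCylinderOpens 1 (0 : ℝ × (EuclideanSpace ℝ (Fin 3)))) Subset.rfl
    refine hd.sub_timeFun ?_
    -- `s ↦ c² h(t + c² s)` is locally integrable on `Q(0,1)` (transport along the zoom)
    have hF := (hh.comp_stAffine hc2 hc z.1 z.2).smul (c ^ 2)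
    have e : (c ^ 2) • ((fun w : ℝ × (EuclideanSpace ℝ (Fin 3)) => h w.1) ∘ stAffine (c ^ 2) c z.1 z.2) =
        fun w : ℝ × (EuclideanSpace ℝ (Fin 3)) => hz w.1 := by
      funext w
      simp [hhz_def, stAffine, smul_eq_mul]
    rw [e, ← hΦ_def, hpre] at hF
    exact hF
  -- the velocity bound `|v| ≤ A` on `Q(0, 1)`
  have hbd' : ∀ᵐ w ∂(volume.restrict (parabolicCylinder 1 (0 : ℝ × (EuclideanSpace ℝ (Fin 3))))), ‖v w.1 w.2‖ ≤ A := by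
    filter_upwards [ae_restrict_mem (isOpen_parabolicCylinder 1 0).measurableSet] with w hw'
    have hΦw : Φ w ∈ Q := by rw [← mem_preimage, hpre]; exact hw'
    have hb := hbd (Φ w) hΦw
    have e : v w.1 w.2 = c • u (Φ w).1 (Φ w).2 := rfl
    rw [e, norm_smul, Real.norm_of_nonneg hc.le]
    calc c * ‖u (Φ w).1 (Φ w).2‖ ≤ c * (A / c) := by gcongr
      _ = A := by field_simp
  -- the pressure bound `∫∫_{Q(0,1)} |q - hz|^{3/2} ≤ P`
  have hP' : ∫⁻ w in parabolicCylinder 1 (0 : ℝ × (EuclideanSpace ℝ (Fin 3))), ‖q w.1 w.2 - hz w.1‖ₑ ^ (3 / 2 : ℝ) ≤ P := by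
    have e : (fun w : ℝ × (EuclideanSpace ℝ (Fin 3)) => ‖q w.1 w.2 - hz w.1‖ₑ ^ (3 / 2 : ℝ)) =
        fun w => ‖(c ^ 2 • stPull (c ^ 2) c z.1 z.2 ph) w.1 w.2‖ₑ ^ (3 / 2 : ℝ) := by
      funext w
      congr 2
      simp only [hq_def, hph_def, hhz_def, Pi.smul_apply, stPull_apply, smul_eq_mul]
      ring
    rw [e, ← hpre, hΦ_def, setLIntegral_enorm_rpow_stRescale hc2 hc z.1 z.2 (c ^ 2) ph Q
      (r := 3 / 2) (by norm_num), finrank_euclideanSpace_fin]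
    have e0 : (c ^ 2 : ℝ) ^ (3 / 2 : ℝ) = c ^ 3 := by
      rw [show (c ^ 2 : ℝ) = c ^ (2 : ℝ) by norm_cast, ← Real.rpow_mul hc.le,
        show (2 : ℝ) * (3 / 2) = ((3 : ℕ) : ℝ) by norm_num, Real.rpow_natCast]
    have e1 : ‖(c ^ 2 : ℝ)‖ₑ ^ (3 / 2 : ℝ) * ENNReal.ofReal (c ^ 2 * c ^ 3)⁻¹ *
        ENNReal.ofReal (c ^ 2) = 1 := by
      have er : c ^ 3 * (c ^ 2 * c ^ 3)⁻¹ * c ^ 2 = 1 := by field_simp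
      rw [Real.enorm_eq_ofReal hc2.le, ENNReal.ofReal_rpow_of_nonneg hc2.le (by norm_num), e0,
        ← ENNReal.ofReal_mul (pow_nonneg hc.le 3), ← ENNReal.ofReal_mul (by positivity), er,
        ENNReal.ofReal_one]
    calc ‖(c ^ 2 : ℝ)‖ₑ ^ (3 / 2 : ℝ) * ENNReal.ofReal (c ^ 2 * c ^ 3)⁻¹ *
          ∫⁻ w in Q, ‖ph w.1 w.2‖ₑ ^ (3 / 2 : ℝ)
        ≤ ‖(c ^ 2 : ℝ)‖ₑ ^ (3 / 2 : ℝ) * ENNReal.ofReal (c ^ 2 * c ^ 3)⁻¹ *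
            (ENNReal.ofReal (c ^ 2) * P) := by gcongr
      _ = P := by rw [← mul_assoc, e1, one_mul]
  -- the quantitative Serrin theorem
  obtain ⟨V, hVae, -, hVn⟩ := hnorm v _ hdist hbd' hP'
  obtain ⟨hH0, -⟩ := hVn 0 (3 / 4) ⟨by norm_num, by norm_num⟩
  obtain ⟨-, hK1⟩ := hVn 1 (1 / 2) ⟨by norm_num, by norm_num⟩
  -- `V = v` on `Q(0, 3/4)` (both continuous)
  have hVc : ContinuousOn (uncurry V) (parabolicCylinder (3 / 4) (0 : ℝ × (EuclideanSpace ℝ (Fin 3)))) := by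
    have h1 := hH0.continuousOn (hαf 0 (3 / 4) ⟨by norm_num, by norm_num⟩)
    have h2 : ContinuousOn (fun w : ℝ × (EuclideanSpace ℝ (Fin 3)) => (iteratedFDeriv ℝ 0 (V w.1) w.2) (fun _ => 0))
        (parabolicCylinder (3 / 4) (0 : ℝ × (EuclideanSpace ℝ (Fin 3)))) :=
      (continuous_eval_const (fun _ : Fin 0 => (0 : (EuclideanSpace ℝ (Fin 3))))).comp_continuousOn h1
    refine h2.congr fun w _ => ?_
    simp only [iteratedFDeriv_zero_apply]
    rfl
  have hvc : ContinuousOn (uncurry v) (parabolicCylinder 1 (0 : ℝ × (EuclideanSpace ℝ (Fin 3)))) := by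
    have e : uncurry v = c • (uncurry u ∘ Φ) := by funext w; rfl
    rw [e]
    refine ContinuousOn.const_smul (hreg.smooth_velocity.continuousOn.comp
      (continuous_stAffine _ _ _ _).continuousOn fun w hw' => ?_) c
    have hw'' : w ∈ Φ ⁻¹' Q := by rw [hpre]; exact hw'
    exact hw''
  have hsub34 : parabolicCylinder (3 / 4) (0 : ℝ × (EuclideanSpace ℝ (Fin 3))) ⊆ parabolicCylinder 1 0 :=
    prod_mono (Ioo_subset_Ioo (by norm_num) le_rfl) (ball_subset_ball (by norm_num))
  have hsub12 : parabolicCylinder (1 / 2) (0 : ℝ × (EuclideanSpace ℝ (Fin 3))) ⊆ parabolicCylinder (3 / 4) 0 :=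
    prod_mono (Ioo_subset_Ioo (by norm_num) le_rfl) (ball_subset_ball (by norm_num))
  have hEq : EqOn (uncurry v) (uncurry V) (parabolicCylinder (3 / 4) (0 : ℝ × (EuclideanSpace ℝ (Fin 3)))) :=
    Measure.eqOn_open_of_ae_eq (ae_restrict_of_ae_restrict_of_subset hsub34 hVae)
      (isOpen_parabolicCylinder _ _) (hvc.mono hsub34) hVc
  -- the gradient bound for `v` on `Q(0, 1/2)`
  have hgradv : ∀ w' ∈ parabolicCylinder (1 / 2) (0 : ℝ × (EuclideanSpace ℝ (Fin 3))), ‖fderiv ℝ (v w'.1) w'.2‖ ≤ Kf 1 (1 / 2) := by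
    intro w' hw'
    have hev : v w'.1 =ᶠ[𝓝 w'.2] V w'.1 := by
      have hw34 : w' ∈ parabolicCylinder (3 / 4) (0 : ℝ × (EuclideanSpace ℝ (Fin 3))) := hsub12 hw'
      rw [mem_parabolicCylinder] at hw34
      have hopen : IsOpen {y : (EuclideanSpace ℝ (Fin 3)) | dist y (0 : ℝ × (EuclideanSpace ℝ (Fin 3))).2 < 3 / 4} :=
        isOpen_lt (continuous_id.dist continuous_const) continuous_const
      filter_upwards [hopen.mem_nhds hw34.2] with y hy
      have hmem : ((w'.1, y) : ℝ × (EuclideanSpace ℝ (Fin 3))) ∈ parabolicCylinder (3 / 4) (0 : ℝ × (EuclideanSpace ℝ (Fin 3))) :=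
        mem_parabolicCylinder.2 ⟨hw34.1, hy⟩
      exact hEq hmem
    rw [hev.fderiv_eq, ← norm_iteratedFDeriv_one]
    exact hK1 w' hw'
  -- unscale
  set w' : ℝ × (EuclideanSpace ℝ (Fin 3)) := ((w.1 - z.1) / c ^ 2, c⁻¹ • (w.2 - z.2)) with hw'_def
  have hw'mem : w' ∈ parabolicCylinder (1 / 2) (0 : ℝ × (EuclideanSpace ℝ (Fin 3))) := by
    have : w ∈ parabolicCylinder (c * (1 / 2)) z := by rwa [mul_one_div]
    exact inv_zoom_mem_parabolicCylinder hc this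
  set g : (EuclideanSpace ℝ (Fin 3)) → (EuclideanSpace ℝ (Fin 3)) := fun x => u w.1 (z.2 + x) with hg_def
  have hslice : v w'.1 = fun y => c • g (c • y) := by
    funext y
    simp only [hv_def, hg_def, Pi.smul_apply, stPull_apply, hw'_def]
    congr 2
    field_simp
    ring
  have hfd : fderiv ℝ (v w'.1) w'.2 = c ^ 2 • fderiv ℝ (u w.1) w.2 := by
    rw [hslice, fderiv_smul_comp_smul g c w'.2, hg_def, fderiv_comp_add_left]
    congr 2
    simp only [hw'_def]
    rw [smul_smul, mul_inv_cancel₀ hc.ne', one_smul, add_sub_cancel]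
  have key := hgradv w' hw'mem
  rw [hfd, norm_smul, Real.norm_of_nonneg hc2.le] at key
  rw [le_div_iff₀ hc2, mul_comm]
  exact key

end Serrin

section FarField

/-- `∫_{|ζ| > 2} |ζ|⁻⁴ dζ < ∞` in `ℝ³` (compare with `(1 + |ζ|)⁻⁴`, integrable since `4 > 3`).
[folklore] -/
theorem lintegral_norm_rpow_neg_four_lt_top :
    ∫⁻ ζ in {ζ : (EuclideanSpace ℝ (Fin 3)) | 2 < ‖ζ‖}, ENNReal.ofReal (‖ζ‖ ^ (-(4 : ℝ))) < ⊤ := by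
  have hfin := finite_integral_one_add_norm (E := (EuclideanSpace ℝ (Fin 3))) (μ := volume) (r := 4)
    (by rw [finrank_euclideanSpace_fin]; norm_num)
  have hle : ∀ ζ ∈ {ζ : (EuclideanSpace ℝ (Fin 3)) | 2 < ‖ζ‖}, ENNReal.ofReal (‖ζ‖ ^ (-(4 : ℝ))) ≤
      ENNReal.ofReal ((3 / 2 : ℝ) ^ (4 : ℝ)) * ENNReal.ofReal ((1 + ‖ζ‖) ^ (-(4 : ℝ))) := by
    intro ζ hζ
    have hζ' : (2 : ℝ) < ‖ζ‖ := hζ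
    have h0 : 0 < ‖ζ‖ := by linarith
    rw [← ENNReal.ofReal_mul (by positivity)]
    refine ENNReal.ofReal_le_ofReal ?_
    have h1 : (1 + ‖ζ‖) ^ (4 : ℝ) ≤ ((3 / 2) * ‖ζ‖) ^ (4 : ℝ) :=
      Real.rpow_le_rpow (by positivity) (by linarith) (by norm_num)
    rw [Real.mul_rpow (by norm_num) h0.le] at h1
    have hp1 : 0 < (1 + ‖ζ‖) ^ (4 : ℝ) := by positivity
    have hp2 : 0 < ‖ζ‖ ^ (4 : ℝ) := by positivity
    rw [Real.rpow_neg h0.le, Real.rpow_neg (by positivity), ← div_eq_mul_inv, le_div_iff₀ hp1,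
      inv_mul_le_iff₀ hp2]
    linarith
  calc ∫⁻ ζ in {ζ : (EuclideanSpace ℝ (Fin 3)) | 2 < ‖ζ‖}, ENNReal.ofReal (‖ζ‖ ^ (-(4 : ℝ)))
      ≤ ∫⁻ ζ in {ζ : (EuclideanSpace ℝ (Fin 3)) | 2 < ‖ζ‖},
          ENNReal.ofReal ((3 / 2 : ℝ) ^ (4 : ℝ)) * ENNReal.ofReal ((1 + ‖ζ‖) ^ (-(4 : ℝ))) :=
        setLIntegral_mono' (measurableSet_lt measurable_const continuous_norm.measurable) hle
    _ ≤ ∫⁻ ζ, ENNReal.ofReal ((3 / 2 : ℝ) ^ (4 : ℝ)) * ENNReal.ofReal ((1 + ‖ζ‖) ^ (-(4 : ℝ))) :=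
        setLIntegral_le_lintegral _ _
    _ = ENNReal.ofReal ((3 / 2 : ℝ) ^ (4 : ℝ)) * ∫⁻ ζ : (EuclideanSpace ℝ (Fin 3)), ENNReal.ofReal ((1 + ‖ζ‖) ^ (-(4 : ℝ))) := by
        rw [lintegral_const_mul' _ _ ENNReal.ofReal_ne_top]
    _ < ⊤ := ENNReal.mul_lt_top ENNReal.ofReal_lt_top hfin

/-- `∫_{B₁} |η|⁻² dη < ∞` in `ℝ³`. [folklore] -/
theorem lintegral_ball_norm_rpow_neg_two_lt_top :
    ∫⁻ η in ball (0 : (EuclideanSpace ℝ (Fin 3))) 1, ENNReal.ofReal (‖η‖ ^ (-(2 : ℝ))) < ⊤ := by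
  have h1 : IntegrableOn (fun x : (EuclideanSpace ℝ (Fin 3)) => ‖x‖ ^ (-(2 : ℝ))) (ball 0 1) volume := by
    refine integrableOn_ball_of_norm_le_rpow (by rw [finrank_euclideanSpace_fin]; norm_num)
      (C := 1) (α := 2) (by rw [finrank_euclideanSpace_fin]; norm_num)
      (Eventually.of_forall fun y => ?_) ?_
    · rw [Real.norm_of_nonneg (Real.rpow_nonneg (norm_nonneg _) _), one_mul]
    · exact (continuous_norm.measurable.pow_const _).aestronglyMeasurable
  calc ∫⁻ x in ball (0 : (EuclideanSpace ℝ (Fin 3))) 1, ENNReal.ofReal (‖x‖ ^ (-(2 : ℝ)))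
      = ∫⁻ x in ball (0 : (EuclideanSpace ℝ (Fin 3))) 1, ‖‖x‖ ^ (-(2 : ℝ))‖ₑ :=
        lintegral_congr fun x => (Real.enorm_eq_ofReal (Real.rpow_nonneg (norm_nonneg _) _)).symm
    _ < ⊤ := h1.2

/-- **The far-field weight at unit scale**: `sup_ξ ∫_{|η − ξ| > 2} |η|⁻² |η − ξ|⁻⁴ dη < ∞`
(split `|η| < 1`, where `|η − ξ|⁻⁴ ≤ 2⁻⁴`, and `|η| ≥ 1`, where `|η|⁻² ≤ 1`). [folklore] -/
theorem exists_farField_unit_bound :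
    ∃ G : ℝ≥0∞, G < ⊤ ∧ ∀ ξ : (EuclideanSpace ℝ (Fin 3)),
      ∫⁻ η in {η : (EuclideanSpace ℝ (Fin 3)) | 2 < ‖η - ξ‖},
        ENNReal.ofReal (‖η‖ ^ (-(2 : ℝ))) * ENNReal.ofReal (‖η - ξ‖ ^ (-(4 : ℝ))) ≤ G := by
  set I₁ : ℝ≥0∞ := ∫⁻ η in ball (0 : (EuclideanSpace ℝ (Fin 3))) 1, ENNReal.ofReal (‖η‖ ^ (-(2 : ℝ))) with hI₁
  set I₂ : ℝ≥0∞ := ∫⁻ ζ in {ζ : (EuclideanSpace ℝ (Fin 3)) | 2 < ‖ζ‖}, ENNReal.ofReal (‖ζ‖ ^ (-(4 : ℝ))) with hI₂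
  refine ⟨I₁ + I₂, ENNReal.add_lt_top.2 ⟨lintegral_ball_norm_rpow_neg_two_lt_top,
    lintegral_norm_rpow_neg_four_lt_top⟩, fun ξ => ?_⟩
  set S : Set (EuclideanSpace ℝ (Fin 3)) := {η : (EuclideanSpace ℝ (Fin 3)) | 2 < ‖η - ξ‖} with hS
  have hSm : MeasurableSet S :=
    measurableSet_lt measurable_const (continuous_id.sub continuous_const).norm.measurable
  -- pointwise splitting of the integrand on `S`
  set f : (EuclideanSpace ℝ (Fin 3)) → ℝ≥0∞ := fun η =>
    ENNReal.ofReal (‖η‖ ^ (-(2 : ℝ))) * ENNReal.ofReal (‖η - ξ‖ ^ (-(4 : ℝ))) with hf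
  set g₁ : (EuclideanSpace ℝ (Fin 3)) → ℝ≥0∞ := (ball (0 : (EuclideanSpace ℝ (Fin 3))) 1).indicator fun η => ENNReal.ofReal (‖η‖ ^ (-(2 : ℝ)))
    with hg₁
  set g₂ : (EuclideanSpace ℝ (Fin 3)) → ℝ≥0∞ := S.indicator fun η => ENNReal.ofReal (‖η - ξ‖ ^ (-(4 : ℝ))) with hg₂
  have hpt : ∀ η ∈ S, f η ≤ g₁ η + g₂ η := by
    intro η hη
    have hη' : (2 : ℝ) < ‖η - ξ‖ := hη
    by_cases h1 : η ∈ ball (0 : (EuclideanSpace ℝ (Fin 3))) 1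
    · -- `|η − ξ|⁻⁴ ≤ 1`
      have hb : ENNReal.ofReal (‖η - ξ‖ ^ (-(4 : ℝ))) ≤ 1 := by
        rw [← ENNReal.ofReal_one]
        refine ENNReal.ofReal_le_ofReal ?_
        rw [Real.rpow_neg (norm_nonneg _)]
        exact inv_le_one_of_one_le₀ (Real.one_le_rpow (by linarith) (by norm_num))
      calc f η ≤ ENNReal.ofReal (‖η‖ ^ (-(2 : ℝ))) * 1 := mul_le_mul' le_rfl hb
        _ = g₁ η := by rw [mul_one, hg₁, indicator_of_mem h1]
        _ ≤ g₁ η + g₂ η := le_self_add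
    · -- `|η|⁻² ≤ 1`
      have hn : 1 ≤ ‖η‖ := by
        rw [mem_ball_zero_iff, not_lt] at h1; exact h1
      have ha : ENNReal.ofReal (‖η‖ ^ (-(2 : ℝ))) ≤ 1 := by
        rw [← ENNReal.ofReal_one]
        refine ENNReal.ofReal_le_ofReal ?_
        rw [Real.rpow_neg (norm_nonneg _)]
        exact inv_le_one_of_one_le₀ (Real.one_le_rpow hn (by norm_num))
      calc f η ≤ 1 * ENNReal.ofReal (‖η - ξ‖ ^ (-(4 : ℝ))) := mul_le_mul' ha le_rfl
        _ = g₂ η := by rw [one_mul, hg₂, indicator_of_mem hη]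
        _ ≤ g₁ η + g₂ η := le_add_self
  have hg₂m : Measurable g₂ := by
    refine Measurable.indicator ?_ hSm
    exact ((continuous_id.sub continuous_const).norm.measurable.pow_const _).ennreal_ofReal
  calc ∫⁻ η in S, f η ≤ ∫⁻ η in S, (g₁ η + g₂ η) := setLIntegral_mono' hSm hpt
    _ ≤ ∫⁻ η, (g₁ η + g₂ η) := setLIntegral_le_lintegral _ _
    _ = (∫⁻ η, g₁ η) + ∫⁻ η, g₂ η := lintegral_add_right _ hg₂m
    _ = I₁ + I₂ := by
        rw [hg₁, lintegral_indicator measurableSet_ball, hg₂, lintegral_indicator hSm, hI₂]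
        congr 1
        -- translate: `∫_{|η-ξ|>2} |η-ξ|⁻⁴ dη = ∫_{|ζ|>2} |ζ|⁻⁴ dζ`
        have h := lintegral_sub_right_eq_self (μ := (volume : Measure (EuclideanSpace ℝ (Fin 3))))
          (fun ζ : (EuclideanSpace ℝ (Fin 3)) => ({ζ : (EuclideanSpace ℝ (Fin 3)) | 2 < ‖ζ‖} : Set (EuclideanSpace ℝ (Fin 3))).indicator
            (fun ζ => ENNReal.ofReal (‖ζ‖ ^ (-(4 : ℝ)))) ζ) ξ
        rw [← lintegral_indicator (measurableSet_lt measurable_const continuous_norm.measurable),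
          ← h, ← lintegral_indicator hSm]
        refine lintegral_congr fun η => ?_
        simp only [indicator, mem_setOf_eq, hS]

/-- **The far-field weight at scale `c`**: for all `x` and `c > 0`,
`∫_{|y − x| > 2c} |y|⁻² |y − x|⁻⁴ dy ≤ G c⁻³` (scaling `y = c η`). [folklore] -/
theorem exists_farField_bound :
    ∃ G : ℝ≥0∞, G < ⊤ ∧ ∀ (x : (EuclideanSpace ℝ (Fin 3))) (c : ℝ), 0 < c →
      ∫⁻ y in {y : (EuclideanSpace ℝ (Fin 3)) | 2 * c < ‖y - x‖},
        ENNReal.ofReal (‖y‖ ^ (-(2 : ℝ))) * ENNReal.ofReal (‖y - x‖ ^ (-(4 : ℝ))) ≤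
          G * ENNReal.ofReal (c ^ 3)⁻¹ := by
  obtain ⟨G, hG, hGb⟩ := exists_farField_unit_bound
  refine ⟨G, hG, fun x c hc => ?_⟩
  set S : Set (EuclideanSpace ℝ (Fin 3)) := {y : (EuclideanSpace ℝ (Fin 3)) | 2 * c < ‖y - x‖} with hS
  have hSm : MeasurableSet S :=
    measurableSet_lt measurable_const (continuous_id.sub continuous_const).norm.measurable
  set F : (EuclideanSpace ℝ (Fin 3)) → ℝ≥0∞ := S.indicator fun y =>
    ENNReal.ofReal (‖y‖ ^ (-(2 : ℝ))) * ENNReal.ofReal (‖y - x‖ ^ (-(4 : ℝ))) with hF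
  -- `∫ F = c³ ∫ F(c η) dη`
  have hscale := lintegral_comp_space_affine hc (0 : (EuclideanSpace ℝ (Fin 3))) F
  simp only [zero_add, finrank_euclideanSpace_fin] at hscale
  -- `F(c η) = c⁻⁶ 𝟙_{|η - x/c| > 2} |η|⁻² |η - x/c|⁻⁴`
  set ξ : (EuclideanSpace ℝ (Fin 3)) := c⁻¹ • x with hξ
  have hFc : ∀ η : (EuclideanSpace ℝ (Fin 3)), F (c • η) = ENNReal.ofReal ((c ^ 6)⁻¹) *
      ({η : (EuclideanSpace ℝ (Fin 3)) | 2 < ‖η - ξ‖} : Set (EuclideanSpace ℝ (Fin 3))).indicator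
        (fun η => ENNReal.ofReal (‖η‖ ^ (-(2 : ℝ))) * ENNReal.ofReal (‖η - ξ‖ ^ (-(4 : ℝ)))) η := by
    intro η
    have hsub : c • η - x = c • (η - ξ) := by
      rw [hξ, smul_sub, smul_smul, mul_inv_cancel₀ hc.ne', one_smul]
    have hmem : c • η ∈ S ↔ η ∈ ({η : (EuclideanSpace ℝ (Fin 3)) | 2 < ‖η - ξ‖} : Set (EuclideanSpace ℝ (Fin 3))) := by
      simp only [hS, mem_setOf_eq, hsub, norm_smul, Real.norm_of_nonneg hc.le]
      constructor
      · intro h; nlinarith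
      · intro h; nlinarith
    by_cases hη : η ∈ ({η : (EuclideanSpace ℝ (Fin 3)) | 2 < ‖η - ξ‖} : Set (EuclideanSpace ℝ (Fin 3)))
    · rw [hF, indicator_of_mem (hmem.2 hη), indicator_of_mem hη, hsub, norm_smul, norm_smul,
        Real.norm_of_nonneg hc.le, Real.mul_rpow hc.le (norm_nonneg _),
        Real.mul_rpow hc.le (norm_nonneg _), ENNReal.ofReal_mul (Real.rpow_nonneg hc.le _),
        ENNReal.ofReal_mul (Real.rpow_nonneg hc.le _)]
      have e6r : c ^ (-(2 : ℝ)) * c ^ (-(4 : ℝ)) = (c ^ 6)⁻¹ := by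
        rw [← Real.rpow_add hc, show (-(2 : ℝ)) + -(4 : ℝ) = -((6 : ℕ) : ℝ) by norm_num,
          Real.rpow_neg hc.le, Real.rpow_natCast]
      have e6 : ENNReal.ofReal (c ^ (-(2 : ℝ))) * ENNReal.ofReal (c ^ (-(4 : ℝ))) =
          ENNReal.ofReal ((c ^ 6)⁻¹) := by
        rw [← ENNReal.ofReal_mul (Real.rpow_nonneg hc.le _), e6r]
      rw [← e6]
      ring
    · rw [hF, indicator_of_notMem (fun h => hη (hmem.1 h)), indicator_of_notMem hη, mul_zero]
  have hTm : MeasurableSet ({η : (EuclideanSpace ℝ (Fin 3)) | 2 < ‖η - ξ‖} : Set (EuclideanSpace ℝ (Fin 3))) :=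
    measurableSet_lt measurable_const (continuous_id.sub continuous_const).norm.measurable
  have hmeas : Measurable fun η : (EuclideanSpace ℝ (Fin 3)) =>
      ({η : (EuclideanSpace ℝ (Fin 3)) | 2 < ‖η - ξ‖} : Set (EuclideanSpace ℝ (Fin 3))).indicator
        (fun η => ENNReal.ofReal (‖η‖ ^ (-(2 : ℝ))) * ENNReal.ofReal (‖η - ξ‖ ^ (-(4 : ℝ)))) η := by
    refine Measurable.indicator ?_ hTm
    exact ((continuous_norm.measurable.pow_const _).ennreal_ofReal).mul
      (((continuous_id.sub continuous_const).norm.measurable.pow_const _).ennreal_ofReal)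
  have key : ∫⁻ y, F y = ENNReal.ofReal (c ^ 3) * (ENNReal.ofReal ((c ^ 6)⁻¹) *
      ∫⁻ η in {η : (EuclideanSpace ℝ (Fin 3)) | 2 < ‖η - ξ‖},
        ENNReal.ofReal (‖η‖ ^ (-(2 : ℝ))) * ENNReal.ofReal (‖η - ξ‖ ^ (-(4 : ℝ)))) := by
    have h1 : ∫⁻ η, F (c • η) = ENNReal.ofReal ((c ^ 6)⁻¹) *
        ∫⁻ η in {η : (EuclideanSpace ℝ (Fin 3)) | 2 < ‖η - ξ‖},
          ENNReal.ofReal (‖η‖ ^ (-(2 : ℝ))) * ENNReal.ofReal (‖η - ξ‖ ^ (-(4 : ℝ))) := by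
      simp_rw [hFc]
      rw [lintegral_const_mul _ hmeas, lintegral_indicator hTm]
    rw [← h1, hscale, ← mul_assoc, ← ENNReal.ofReal_mul (by positivity),
      mul_inv_cancel₀ (by positivity), ENNReal.ofReal_one, one_mul]
  rw [← lintegral_indicator hSm, ← hF, key]
  calc ENNReal.ofReal (c ^ 3) * (ENNReal.ofReal ((c ^ 6)⁻¹) *
        ∫⁻ η in {η : (EuclideanSpace ℝ (Fin 3)) | 2 < ‖η - ξ‖},
          ENNReal.ofReal (‖η‖ ^ (-(2 : ℝ))) * ENNReal.ofReal (‖η - ξ‖ ^ (-(4 : ℝ))))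
      ≤ ENNReal.ofReal (c ^ 3) * (ENNReal.ofReal ((c ^ 6)⁻¹) * G) := by gcongr; exact hGb ξ
    _ = G * ENNReal.ofReal (c ^ 3)⁻¹ := by
        rw [← mul_assoc, ← ENNReal.ofReal_mul (by positivity), mul_comm G]
        congr 1
        congr 1
        field_simp

end FarField

section Decay

-- nested operator types
set_option maxSynthPendingDepth 3

variable {u : ℝ → (EuclideanSpace ℝ (Fin 3)) → (EuclideanSpace ℝ (Fin 3))} {p : ℝ → (EuclideanSpace ℝ (Fin 3)) → ℝ} {Cu Cp : ℝ}

/-- The space–time pressure identity `∫∫_Q (⟨u, (u·∇)∇φ⟩ + p Δφ) = 0` of a classical solution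
(`ν = 1`, `f = 0`) on every open cylinder inside its region (the distributional pressure Poisson
equation of the tree, `IsDistributionalNSSolutionOn.integral_hessian_add_pressure_laplacian_eq_zero`,
for the distributional solution furnished by `IsClassicalNSSolutionOnRegion.isDistributionalNSSolutionOn`).
[cite: CaffarelliKohnNirenberg1982, §2] -/
theorem IsClassicalNSSolutionOnRegion.pressure_identity_cylinder {O : Set (ℝ × (EuclideanSpace ℝ (Fin 3)))}
    (hO : IsOpen O) (h : IsClassicalNSSolutionOnRegion O 1 0 u p) {ρ : ℝ} {z : ℝ × (EuclideanSpace ℝ (Fin 3))}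
    (hQ : parabolicCylinder ρ z ⊆ O) :
    ∀ φ : ℝ → (EuclideanSpace ℝ (Fin 3)) → ℝ, IsSpaceTimeTestOn (parabolicCylinderOpens ρ z) φ →
      ∫ w in parabolicCylinder ρ z,
        (⟪u w.1 w.2, convect (u w.1) (gradient (φ w.1)) w.2⟫ + p w.1 w.2 * Δ (φ w.1) w.2) = 0 := by
  intro φ hφ
  have hd := h.isDistributionalNSSolutionOn hO (Q := parabolicCylinderOpens ρ z) hQ
  have key := hd.integral_hessian_add_pressure_laplacian_eq_zero
    (f := (0 : ℝ → (EuclideanSpace ℝ (Fin 3)) → (EuclideanSpace ℝ (Fin 3))))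
    ((continuous_zero.continuousOn).locallyIntegrableOn
      (isOpen_parabolicCylinder ρ z).measurableSet) (fun θ _ => by simp) hφ
  rw [coe_parabolicCylinderOpens] at key
  refine Eq.trans (setIntegral_congr_fun (isOpen_parabolicCylinder ρ z).measurableSet
    fun w _ => ?_) key
  simp only [convect]
  rw [inner_fderiv_gradient_apply (contDiff_infty.1 (hφ.contDiff_slice w.1) 2)]

/-- **The pressure oscillation on the Serrin cylinder is controlled at small scales** (the
replacement of the pressure-free Lemma 9.1 in the tree's rendering of Lemma 9.2): for a
classical solution on `[−1,0) × B₁` with the Type I bound (1.15), a point `(x, t)` with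
`|x| + √(−t) ≤ 1/64`, and `ρ = (|x| + √(−t))/8`, the mean-free pressure on `Q((t,x), ρ)`
satisfies
`∫∫_{Q_ρ} |p − (p)_{B(x,ρ)}(t')|^{3/2} ≤ ρ² C₂ C_u³ (8|B₁| + G^{3/2}) + C₂ (64ρ)^{9/2} (B_u + B_p)`,
where `C₂` is the constant of the local pressure estimate (Robinson–Rodrigo–Sadowski, Lemma
15.12, the tree's `RRS2016.lemma15_12_holds`, applied on `Q((t,x), 1/64)` with inner radius
`ρ`), `G` the far-field weight bound (`exists_farField_bound`), and `B_u`, `B_p` bound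
`∫∫ |u|³` on `(−1,0) × B₁` and `∫∫ |p|^{3/2}` on `(−1,0) × B_{1/32}`: the near term by
`|u| ≤ 8C_u/(|x|+√(−t))` on `Q((t,x), 2ρ)` (the geometry of Lemma 9.2), the far term by
`|u(t', y)| ≤ C_u/|y|`. [cite: PineauVicol2026, proof of Lemma 9.2, arXiv:2607.09619 p. 30] -/
theorem lintegral_pressure_osc_le {C₂ : ℝ}
    (hRRS : ∀ (z : ℝ × (EuclideanSpace ℝ (Fin 3))) (ρ : ℝ) (u : ℝ → (EuclideanSpace ℝ (Fin 3)) → (EuclideanSpace ℝ (Fin 3))) (p : ℝ → (EuclideanSpace ℝ (Fin 3)) → ℝ), 0 < ρ →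
      AEStronglyMeasurable (uncurry u) (volume.restrict (parabolicCylinder ρ z)) →
      AEStronglyMeasurable (uncurry p) (volume.restrict (parabolicCylinder ρ z)) →
      ∫⁻ w in parabolicCylinder ρ z, ‖u w.1 w.2‖ₑ ^ (3 : ℕ) < ∞ →
      ∫⁻ w in parabolicCylinder ρ z, ‖p w.1 w.2‖ₑ ^ (3 / 2 : ℝ) < ∞ →
      (∀ φ : ℝ → (EuclideanSpace ℝ (Fin 3)) → ℝ, IsSpaceTimeTestOn (parabolicCylinderOpens ρ z) φ →
        ∫ w in parabolicCylinder ρ z,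
          (⟪u w.1 w.2, convect (u w.1) (gradient (φ w.1)) w.2⟫ + p w.1 w.2 * Δ (φ w.1) w.2) = 0) →
      ∀ r : ℝ, 0 < r → r ≤ ρ / 2 →
        ∀ᵐ t ∂(volume.restrict (Ioo (z.1 - ρ ^ 2) z.1)),
          ∫⁻ x in ball z.2 r, ‖p t x - ⨍ y in ball z.2 r, p t y‖ₑ ^ (3 / 2 : ℝ) ≤
            ENNReal.ofReal C₂ * (∫⁻ x in ball z.2 (2 * r), ‖u t x‖ₑ ^ (3 : ℕ)) +
            ENNReal.ofReal C₂ * ENNReal.ofReal (r ^ (9 / 2 : ℝ)) *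
              (∫⁻ y in {y : (EuclideanSpace ℝ (Fin 3)) | 2 * r < dist y z.2 ∧ dist y z.2 < ρ},
                ‖u t y‖ₑ ^ 2 / ENNReal.ofReal (dist y z.2 ^ 4)) ^ (3 / 2 : ℝ) +
            ENNReal.ofReal C₂ * ENNReal.ofReal (r ^ (9 / 2 : ℝ) / ρ ^ (9 / 2 : ℝ)) *
              ∫⁻ x in ball z.2 ρ, (‖u t x‖ₑ ^ (3 : ℕ) + ‖p t x‖ₑ ^ (3 / 2 : ℝ)))
    {G : ℝ≥0∞}
    (hG : ∀ (x : (EuclideanSpace ℝ (Fin 3))) (c : ℝ), 0 < c →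
      ∫⁻ y in {y : (EuclideanSpace ℝ (Fin 3)) | 2 * c < ‖y - x‖},
        ENNReal.ofReal (‖y‖ ^ (-(2 : ℝ))) * ENNReal.ofReal (‖y - x‖ ^ (-(4 : ℝ))) ≤
          G * ENNReal.ofReal (c ^ 3)⁻¹)
    (hreg : IsClassicalNSSolutionOnRegion (Ico (-1 : ℝ) 0 ×ˢ ball (0 : (EuclideanSpace ℝ (Fin 3))) 1) 1 0 u p)
    (hI : ∀ t ∈ Ico (-1 : ℝ) 0, ∀ x ∈ ball (0 : (EuclideanSpace ℝ (Fin 3))) 1, ‖u t x‖ ≤ Cu / (Real.sqrt (-t) + ‖x‖))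
    {Bu Bp : ℝ≥0∞} (hBut : Bu < ⊤) (hBpt : Bp < ⊤)
    (hBu : ∫⁻ w in Ioo (-1 : ℝ) 0 ×ˢ ball (0 : (EuclideanSpace ℝ (Fin 3))) 1, ‖u w.1 w.2‖ₑ ^ (3 : ℕ) ≤ Bu)
    (hBp : ∫⁻ w in Ioo (-1 : ℝ) 0 ×ˢ ball (0 : (EuclideanSpace ℝ (Fin 3))) (1 / 32), ‖p w.1 w.2‖ₑ ^ (3 / 2 : ℝ) ≤ Bp)
    {t : ℝ} {x : (EuclideanSpace ℝ (Fin 3))} (ht : t ∈ Ioo (-1 : ℝ) 0) (hsmall : ‖x‖ + Real.sqrt (-t) ≤ 1 / 64) :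
    ∫⁻ w in parabolicCylinder (min ((1 / 2 : ℝ) / 4) (1 / 6) * (‖x‖ + Real.sqrt (-t))) (t, x),
        ‖p w.1 w.2 - ⨍ y in ball x (min ((1 / 2 : ℝ) / 4) (1 / 6) * (‖x‖ + Real.sqrt (-t))),
          p w.1 y‖ₑ ^ (3 / 2 : ℝ) ≤
      ENNReal.ofReal ((min ((1 / 2 : ℝ) / 4) (1 / 6) * (‖x‖ + Real.sqrt (-t))) ^ 2) *
          (ENNReal.ofReal C₂ * ENNReal.ofReal (Cu ^ 3) *
            (8 * volume (ball (0 : (EuclideanSpace ℝ (Fin 3))) 1) + G ^ (3 / 2 : ℝ))) +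
        ENNReal.ofReal C₂ *
          ENNReal.ofReal ((64 * (min ((1 / 2 : ℝ) / 4) (1 / 6) * (‖x‖ + Real.sqrt (-t)))) ^ (9 / 2 : ℝ)) *
            (Bu + Bp) := by
  ----------------------------------------------------------------
  -- geometry
  ----------------------------------------------------------------
  set m : ℝ := min ((1 / 2 : ℝ) / 4) (1 / 6) with hm_def
  have hm : m = 1 / 8 := by rw [hm_def]; norm_num
  set ρ : ℝ := m * (‖x‖ + Real.sqrt (-t)) with hρ_def
  have ht0 : t < 0 := ht.2
  have hsq : 0 < Real.sqrt (-t) := Real.sqrt_pos.2 (by linarith)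
  have hρ0 : 0 < ρ := pineauVicol_lemma92_radius_pos (x := x) (ε := 1 / 2) (by norm_num) ht0
  have hρle : ρ ≤ 1 / 512 := by rw [hρ_def, hm]; linarith
  have hx : ‖x‖ < 1 - 1 / 2 := by linarith [hsq.le, norm_nonneg x]
  have ht1 : -(1 - 1 / 2 : ℝ) ^ 2 < t := by
    have h1 : Real.sqrt (-t) ≤ 1 / 64 := by linarith [norm_nonneg x]
    have h2 : -t ≤ (1 / 64) ^ 2 := by
      have := Real.sq_sqrt (by linarith : (0 : ℝ) ≤ -t)
      nlinarith [Real.sqrt_nonneg (-t)]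
    nlinarith
  have hCu : 0 ≤ Cu := by
    have h := hI (-(1 / 2 : ℝ)) ⟨by norm_num, by norm_num⟩ 0 (mem_ball_self one_pos)
    rw [norm_zero, add_zero] at h
    have hs : 0 < Real.sqrt (-(-(1 / 2 : ℝ))) := Real.sqrt_pos.2 (by norm_num)
    have h0 : 0 ≤ Cu / Real.sqrt (-(-(1 / 2 : ℝ))) := (norm_nonneg _).trans h
    exact (div_nonneg_iff.1 h0).elim (fun h => h.1) fun h => absurd h.2 (not_le.2 hs)
  have htsmall : -t ≤ (1 / 64 : ℝ) ^ 2 := by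
    have h1 : Real.sqrt (-t) ≤ 1 / 64 := by linarith [norm_nonneg x]
    have := Real.sq_sqrt (by linarith : (0 : ℝ) ≤ -t)
    nlinarith [Real.sqrt_nonneg (-t)]
  have hxsmall : ‖x‖ ≤ 1 / 64 := by linarith [hsq.le]
  set z : ℝ × (EuclideanSpace ℝ (Fin 3)) := (t, x) with hz_def
  have hρρ' : ρ ≤ (1 / 64 : ℝ) / 2 := by linarith
  -- the big cylinder `Q(z, 1/64)` sits inside `(−1, 0) × B_{1/32}`
  have hbig : parabolicCylinder (1 / 64) z ⊆ Ioo (-1 : ℝ) 0 ×ˢ ball (0 : (EuclideanSpace ℝ (Fin 3))) (1 / 32) := by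
    intro w hw
    rw [mem_parabolicCylinder] at hw
    obtain ⟨⟨h1, h2⟩, h3⟩ := hw
    simp only [hz_def] at h1 h2 h3
    refine mk_mem_prod ⟨?_, lt_of_lt_of_le h2 ht0.le⟩ ?_
    · nlinarith
    · rw [mem_ball_zero_iff]
      calc ‖w.2‖ ≤ ‖x‖ + dist w.2 x := by
            rw [dist_eq_norm]
            calc ‖w.2‖ = ‖x + (w.2 - x)‖ := by rw [add_sub_cancel]
              _ ≤ ‖x‖ + ‖w.2 - x‖ := norm_add_le _ _
        _ < 1 / 64 + 1 / 64 := by linarith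
        _ = 1 / 32 := by norm_num
  have hbig1 : parabolicCylinder (1 / 64) z ⊆ Ioo (-1 : ℝ) 0 ×ˢ ball (0 : (EuclideanSpace ℝ (Fin 3))) 1 :=
    hbig.trans (prod_mono Subset.rfl (ball_subset_ball (by norm_num)))
  have hO : IsOpen (Ioo (-1 : ℝ) 0 ×ˢ ball (0 : (EuclideanSpace ℝ (Fin 3))) 1) := isOpen_Ioo.prod isOpen_ball
  have hreg' := hreg.mono_of_isOpen (prod_mono Ioo_subset_Ico_self Subset.rfl) hO
  -- continuity on the big cylinder
  have huc : ContinuousOn (uncurry u) (parabolicCylinder (1 / 64) z) :=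
    hreg'.smooth_velocity.continuousOn.mono hbig1
  have hpc : ContinuousOn (uncurry p) (parabolicCylinder (1 / 64) z) :=
    hreg'.smooth_pressure.continuousOn.mono hbig1
  have hmQ' : MeasurableSet (parabolicCylinder (1 / 64) z) :=
    (isOpen_parabolicCylinder (1 / 64) z).measurableSet
  have huae : AEStronglyMeasurable (uncurry u) (volume.restrict (parabolicCylinder (1 / 64) z)) :=
    huc.aestronglyMeasurable hmQ'
  have hpae : AEStronglyMeasurable (uncurry p) (volume.restrict (parabolicCylinder (1 / 64) z)) :=
    hpc.aestronglyMeasurable hmQ'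
  -- finiteness of `∫∫ |u|³`, `∫∫ |p|^{3/2}` on the big cylinder
  have hBu' : ∫⁻ w in parabolicCylinder (1 / 64) z, ‖u w.1 w.2‖ₑ ^ (3 : ℕ) ≤ Bu :=
    (lintegral_mono_set hbig1).trans hBu
  have hBp' : ∫⁻ w in parabolicCylinder (1 / 64) z, ‖p w.1 w.2‖ₑ ^ (3 / 2 : ℝ) ≤ Bp :=
    (lintegral_mono_set hbig).trans hBp
  ----------------------------------------------------------------
  -- the local pressure estimate on `Q(z, 1/64)` with inner radius `ρ`, a.e. in time
  ----------------------------------------------------------------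
  have hae := hRRS z (1 / 64) u p (by norm_num) huae hpae (lt_of_le_of_lt hBu' hBut)
    (lt_of_le_of_lt hBp' hBpt) (hreg'.pressure_identity_cylinder hO hbig1) ρ hρ0 hρρ'
  set I : Set ℝ := Ioo (t - ρ ^ 2) t with hI_def
  set B : Set (EuclideanSpace ℝ (Fin 3)) := ball x ρ with hB_def
  have hρsq : ρ ^ 2 ≤ (1 / 64 : ℝ) ^ 2 := pow_le_pow_left₀ hρ0.le (by linarith) 2
  have hIsub : I ⊆ Ioo (z.1 - (1 / 64 : ℝ) ^ 2) z.1 := by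
    simp only [hz_def, hI_def]
    exact Ioo_subset_Ioo (by linarith) le_rfl
  have hae' := ae_restrict_of_ae_restrict_of_subset hIsub hae
  simp only [hz_def] at hae'
  -- membership facts for `t' ∈ I`
  have hImem : ∀ t' ∈ I, t' ∈ Ico (-1 : ℝ) 0 ∧ t - (2 * ρ) ^ 2 < t' ∧ t' ≤ t := by
    intro t' ht'
    refine ⟨⟨by nlinarith [ht'.1, ht.1], lt_trans ht'.2 ht0⟩, by nlinarith [ht'.1], ht'.2.le⟩
  ----------------------------------------------------------------
  -- (S1) the near term: `∫_{B(x,2ρ)} |u(t')|³ ≤ (C_u/ρ)³ |B(x, 2ρ)|`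
  ----------------------------------------------------------------
  set V₁ : ℝ≥0∞ := volume (ball (0 : (EuclideanSpace ℝ (Fin 3))) 1) with hV₁
  have hvolB2 : volume (ball x (2 * ρ)) = ENNReal.ofReal ((2 * ρ) ^ 3) * V₁ := by
    rw [Measure.addHaar_ball volume x (by positivity : (0 : ℝ) ≤ 2 * ρ), finrank_euclideanSpace_fin]
  have hS1 : ∀ t' ∈ I, ∫⁻ y in ball x (2 * ρ), ‖u t' y‖ₑ ^ (3 : ℕ) ≤
      ENNReal.ofReal (8 * Cu ^ 3) * V₁ := by
    intro t' ht'
    obtain ⟨-, ht'1, ht'0⟩ := hImem t' ht'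
    have hpt : ∀ y ∈ ball x (2 * ρ), ‖u t' y‖ₑ ^ (3 : ℕ) ≤ ENNReal.ofReal ((Cu / ρ) ^ 3) := by
      intro y hy
      have hb := pineauVicol_lemma92_velocity_bound (ε := 1 / 2) hCu hI (by norm_num) (by norm_num)
        hx ht1 ht0 (mem_ball.1 hy) ht'1 ht'0
      rw [← ofReal_norm, ← ENNReal.ofReal_pow (norm_nonneg _)]
      exact ENNReal.ofReal_le_ofReal (pow_le_pow_left₀ (norm_nonneg _) hb 3)
    calc ∫⁻ y in ball x (2 * ρ), ‖u t' y‖ₑ ^ (3 : ℕ)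
        ≤ ∫⁻ _ in ball x (2 * ρ), ENNReal.ofReal ((Cu / ρ) ^ 3) := setLIntegral_mono' measurableSet_ball hpt
      _ = ENNReal.ofReal ((Cu / ρ) ^ 3) * (ENNReal.ofReal ((2 * ρ) ^ 3) * V₁) := by
          rw [setLIntegral_const, hvolB2]
      _ = ENNReal.ofReal (8 * Cu ^ 3) * V₁ := by
          rw [← mul_assoc, ← ENNReal.ofReal_mul (by positivity)]
          congr 2
          field_simp
          ring
  ----------------------------------------------------------------
  -- (S2) the far term: `∫_{2ρ<|y-x|<1/64} |u(t')|²|y-x|⁻⁴ ≤ C_u² G ρ⁻³`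
  ----------------------------------------------------------------
  have h0 : ∀ᵐ y ∂(volume : Measure (EuclideanSpace ℝ (Fin 3))), y ≠ 0 := by
    rw [ae_iff]
    have : {y : (EuclideanSpace ℝ (Fin 3)) | ¬y ≠ 0} = {0} := by ext y; simp
    rw [this, measure_singleton]
  set Sh : Set (EuclideanSpace ℝ (Fin 3)) := {y : (EuclideanSpace ℝ (Fin 3)) | 2 * ρ < dist y x ∧ dist y x < 1 / 64} with hSh
  have hShm : MeasurableSet Sh :=
    (measurableSet_lt measurable_const (continuous_id.dist continuous_const).measurable).inter
      (measurableSet_lt (continuous_id.dist continuous_const).measurable measurable_const)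
  have hS2 : ∀ t' ∈ I, ∫⁻ y in Sh, ‖u t' y‖ₑ ^ 2 / ENNReal.ofReal (dist y x ^ 4) ≤
      ENNReal.ofReal (Cu ^ 2) * (G * ENNReal.ofReal (ρ ^ 3)⁻¹) := by
    intro t' ht'
    obtain ⟨ht'I, -, -⟩ := hImem t' ht'
    have hpt : ∀ᵐ y ∂(volume.restrict Sh), ‖u t' y‖ₑ ^ 2 / ENNReal.ofReal (dist y x ^ 4) ≤
        ENNReal.ofReal (Cu ^ 2) *
          (ENNReal.ofReal (‖y‖ ^ (-(2 : ℝ))) * ENNReal.ofReal (‖y - x‖ ^ (-(4 : ℝ)))) := by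
      filter_upwards [ae_restrict_mem hShm, ae_restrict_of_ae h0] with y hy hy0
      have hyball : y ∈ ball (0 : (EuclideanSpace ℝ (Fin 3))) 1 := by
        rw [mem_ball_zero_iff]
        calc ‖y‖ ≤ ‖x‖ + dist y x := by
              rw [dist_eq_norm]
              calc ‖y‖ = ‖x + (y - x)‖ := by rw [add_sub_cancel]
                _ ≤ ‖x‖ + ‖y - x‖ := norm_add_le _ _
          _ < 1 / 64 + 1 / 64 := by linarith [hy.2]
          _ < 1 := by norm_num
      have hypos : 0 < ‖y‖ := norm_pos_iff.2 hy0
      have hdpos : 0 < dist y x := lt_trans (by positivity) hy.1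
      have hu1 : ‖u t' y‖ ≤ Cu / ‖y‖ := by
        refine (hI t' ht'I y hyball).trans (div_le_div_of_nonneg_left hCu hypos ?_)
        linarith [Real.sqrt_nonneg (-t')]
      have hu2 : ‖u t' y‖ₑ ^ 2 ≤ ENNReal.ofReal (Cu ^ 2) * ENNReal.ofReal (‖y‖ ^ (-(2 : ℝ))) := by
        rw [← ofReal_norm, ← ENNReal.ofReal_pow (norm_nonneg _), ← ENNReal.ofReal_mul (sq_nonneg _)]
        refine ENNReal.ofReal_le_ofReal ?_
        have : (Cu / ‖y‖) ^ 2 = Cu ^ 2 * ‖y‖ ^ (-(2 : ℝ)) := by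
          rw [Real.rpow_neg (norm_nonneg _), Real.rpow_two, div_pow, div_eq_mul_inv]
        rw [← this]
        exact pow_le_pow_left₀ (norm_nonneg _) hu1 2
      have hd : (ENNReal.ofReal (dist y x ^ 4))⁻¹ = ENNReal.ofReal (‖y - x‖ ^ (-(4 : ℝ))) := by
        rw [dist_eq_norm] at hdpos ⊢
        rw [Real.rpow_neg (norm_nonneg _), show ((4 : ℝ)) = ((4 : ℕ) : ℝ) by norm_num,
          Real.rpow_natCast, ENNReal.ofReal_inv_of_pos (pow_pos hdpos 4)]
      rw [div_eq_mul_inv, hd]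
      calc ‖u t' y‖ₑ ^ 2 * ENNReal.ofReal (‖y - x‖ ^ (-(4 : ℝ)))
          ≤ (ENNReal.ofReal (Cu ^ 2) * ENNReal.ofReal (‖y‖ ^ (-(2 : ℝ)))) *
              ENNReal.ofReal (‖y - x‖ ^ (-(4 : ℝ))) := mul_le_mul' hu2 le_rfl
        _ = _ := by ring
    have hShsub : Sh ⊆ {y : (EuclideanSpace ℝ (Fin 3)) | 2 * ρ < ‖y - x‖} := fun y hy => by
      have := hy.1; rwa [dist_eq_norm] at this
    calc ∫⁻ y in Sh, ‖u t' y‖ₑ ^ 2 / ENNReal.ofReal (dist y x ^ 4)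
        ≤ ∫⁻ y in Sh, ENNReal.ofReal (Cu ^ 2) *
            (ENNReal.ofReal (‖y‖ ^ (-(2 : ℝ))) * ENNReal.ofReal (‖y - x‖ ^ (-(4 : ℝ)))) :=
          lintegral_mono_ae hpt
      _ = ENNReal.ofReal (Cu ^ 2) * ∫⁻ y in Sh,
            ENNReal.ofReal (‖y‖ ^ (-(2 : ℝ))) * ENNReal.ofReal (‖y - x‖ ^ (-(4 : ℝ))) := by
          rw [lintegral_const_mul' _ _ ENNReal.ofReal_ne_top]
      _ ≤ ENNReal.ofReal (Cu ^ 2) * ∫⁻ y in {y : (EuclideanSpace ℝ (Fin 3)) | 2 * ρ < ‖y - x‖},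
            ENNReal.ofReal (‖y‖ ^ (-(2 : ℝ))) * ENNReal.ofReal (‖y - x‖ ^ (-(4 : ℝ))) :=
          mul_le_mul' le_rfl (lintegral_mono_set hShsub)
      _ ≤ ENNReal.ofReal (Cu ^ 2) * (G * ENNReal.ofReal (ρ ^ 3)⁻¹) := mul_le_mul' le_rfl (hG x ρ hρ0)
  ----------------------------------------------------------------
  -- the constants of the slice bound
  ----------------------------------------------------------------
  set K₁ : ℝ≥0∞ := ENNReal.ofReal C₂ * (ENNReal.ofReal (8 * Cu ^ 3) * V₁) with hK₁
  set K₂ : ℝ≥0∞ := ENNReal.ofReal C₂ * ENNReal.ofReal (ρ ^ (9 / 2 : ℝ)) *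
    (ENNReal.ofReal (Cu ^ 2) * (G * ENNReal.ofReal (ρ ^ 3)⁻¹)) ^ (3 / 2 : ℝ) with hK₂
  set Rt : ℝ≥0∞ := ENNReal.ofReal C₂ * ENNReal.ofReal (ρ ^ (9 / 2 : ℝ) / (1 / 64 : ℝ) ^ (9 / 2 : ℝ))
    with hRt
  set T3 : ℝ → ℝ≥0∞ := fun t' => ∫⁻ y in ball x (1 / 64),
    (‖u t' y‖ₑ ^ (3 : ℕ) + ‖p t' y‖ₑ ^ (3 / 2 : ℝ)) with hT3
  have hslice : ∀ᵐ t' ∂(volume.restrict I),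
      ∫⁻ y in B, ‖p t' y - ⨍ y' in B, p t' y'‖ₑ ^ (3 / 2 : ℝ) ≤ (K₁ + K₂) + Rt * T3 t' := by
    filter_upwards [hae', ae_restrict_mem measurableSet_Ioo] with t' h1 ht'
    refine h1.trans ?_
    have e1 := hS1 t' ht'
    have e2 := hS2 t' ht'
    rw [hK₁, hK₂]
    gcongr
  ----------------------------------------------------------------
  -- integrate in time: the left side is the cylinder integral (Tonelli)
  ----------------------------------------------------------------
  have hprod : (volume : Measure (ℝ × (EuclideanSpace ℝ (Fin 3)))).restrict (parabolicCylinder ρ z) =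
      (volume.restrict I).prod (volume.restrict B) := by
    rw [RRS2016.volume_restrict_parabolicCylinder ρ z]
  have hQρsub : parabolicCylinder ρ z ⊆ parabolicCylinder (1 / 64) z :=
    prod_mono (Ioo_subset_Ioo (by simp only [hz_def]; linarith) le_rfl) (ball_subset_ball (by linarith))
  have hpQρ : AEStronglyMeasurable (uncurry p) ((volume.restrict I).prod (volume.restrict B)) := by
    rw [← hprod]
    exact (hpc.mono hQρsub).aestronglyMeasurable (isOpen_parabolicCylinder ρ z).measurableSet
  -- measurability of the mean `t' ↦ ⨍_B p(t')`
  have hmean : AEStronglyMeasurable (fun t' => ⨍ y' in B, p t' y') (volume.restrict I) := by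
    have h1 := hpQρ.integral_prod_right'
    have e : (fun t' => ⨍ y' in B, p t' y') = fun t' => (volume.real B)⁻¹ • ∫ y', p t' y' ∂(volume.restrict B) := by
      funext t'
      rw [setAverage_eq]
    rw [e]
    exact h1.const_smul ((volume.real B)⁻¹ : ℝ)
  have hF : AEMeasurable (fun w : ℝ × (EuclideanSpace ℝ (Fin 3)) => ‖p w.1 w.2 - ⨍ y' in B, p w.1 y'‖ₑ ^ (3 / 2 : ℝ))
      ((volume.restrict I).prod (volume.restrict B)) :=
    (hpQρ.sub hmean.comp_fst).enorm.pow_const _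
  have hLHS : ∫⁻ w in parabolicCylinder ρ z, ‖p w.1 w.2 - ⨍ y' in B, p w.1 y'‖ₑ ^ (3 / 2 : ℝ) =
      ∫⁻ t' in I, ∫⁻ y in B, ‖p t' y - ⨍ y' in B, p t' y'‖ₑ ^ (3 / 2 : ℝ) := by
    rw [hprod, lintegral_prod _ hF]
  ----------------------------------------------------------------
  -- the time integral of `T3`
  ----------------------------------------------------------------
  have hprod' : (volume : Measure (ℝ × (EuclideanSpace ℝ (Fin 3)))).restrict (parabolicCylinder (1 / 64) z) =
      (volume.restrict (Ioo (t - (1 / 64 : ℝ) ^ 2) t)).prod (volume.restrict (ball x (1 / 64))) := by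
    rw [RRS2016.volume_restrict_parabolicCylinder (1 / 64) z]
  have hT3m : AEMeasurable (fun w : ℝ × (EuclideanSpace ℝ (Fin 3)) => ‖u w.1 w.2‖ₑ ^ (3 : ℕ) + ‖p w.1 w.2‖ₑ ^ (3 / 2 : ℝ))
      ((volume.restrict (Ioo (t - (1 / 64 : ℝ) ^ 2) t)).prod (volume.restrict (ball x (1 / 64)))) := by
    rw [← hprod']
    exact (huae.enorm.pow_const _).add (hpae.enorm.pow_const _)
  have hT3int : ∫⁻ t' in I, T3 t' ≤ Bu + Bp := by
    calc ∫⁻ t' in I, T3 t' ≤ ∫⁻ t' in Ioo (t - (1 / 64 : ℝ) ^ 2) t, T3 t' :=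
          lintegral_mono_set (by simpa only [hz_def] using hIsub)
      _ = ∫⁻ w in parabolicCylinder (1 / 64) z,
            (‖u w.1 w.2‖ₑ ^ (3 : ℕ) + ‖p w.1 w.2‖ₑ ^ (3 / 2 : ℝ)) := by
          rw [hprod', lintegral_prod _ hT3m]
      _ = (∫⁻ w in parabolicCylinder (1 / 64) z, ‖u w.1 w.2‖ₑ ^ (3 : ℕ)) +
            ∫⁻ w in parabolicCylinder (1 / 64) z, ‖p w.1 w.2‖ₑ ^ (3 / 2 : ℝ) :=
          lintegral_add_left' (huae.enorm.pow_const _) _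
      _ ≤ Bu + Bp := add_le_add hBu' hBp'
  ----------------------------------------------------------------
  -- assemble
  ----------------------------------------------------------------
  have hvolI : volume I = ENNReal.ofReal (ρ ^ 2) := by
    rw [hI_def, Real.volume_Ioo]
    congr 1
    ring
  have hmain : ∫⁻ w in parabolicCylinder ρ z, ‖p w.1 w.2 - ⨍ y' in B, p w.1 y'‖ₑ ^ (3 / 2 : ℝ) ≤
      (K₁ + K₂) * ENNReal.ofReal (ρ ^ 2) + Rt * (Bu + Bp) := by
    rw [hLHS]
    calc ∫⁻ t' in I, ∫⁻ y in B, ‖p t' y - ⨍ y' in B, p t' y'‖ₑ ^ (3 / 2 : ℝ)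
        ≤ ∫⁻ t' in I, ((K₁ + K₂) + Rt * T3 t') := lintegral_mono_ae hslice
      _ = (K₁ + K₂) * volume I + Rt * ∫⁻ t' in I, T3 t' := by
          rw [lintegral_add_left measurable_const, setLIntegral_const, lintegral_const_mul' _ _ ?_]
          rw [hRt]
          exact ENNReal.mul_ne_top ENNReal.ofReal_ne_top ENNReal.ofReal_ne_top
      _ ≤ (K₁ + K₂) * ENNReal.ofReal (ρ ^ 2) + Rt * (Bu + Bp) := by
          rw [hvolI]
          gcongr
  -- identify the constants
  have hK₁' : K₁ = ENNReal.ofReal C₂ * ENNReal.ofReal (Cu ^ 3) * (8 * V₁) := by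
    rw [hK₁, show (8 : ℝ) * Cu ^ 3 = Cu ^ 3 * 8 by ring, ENNReal.ofReal_mul (by positivity),
      ENNReal.ofReal_ofNat]
    ring
  have hK₂' : K₂ = ENNReal.ofReal C₂ * ENNReal.ofReal (Cu ^ 3) * G ^ (3 / 2 : ℝ) := by
    have e1 : (ENNReal.ofReal (Cu ^ 2)) ^ (3 / 2 : ℝ) = ENNReal.ofReal (Cu ^ 3) := by
      rw [ENNReal.ofReal_rpow_of_nonneg (sq_nonneg _) (by norm_num)]
      congr 1
      rw [show (Cu ^ 2 : ℝ) = Cu ^ (2 : ℝ) by norm_cast, ← Real.rpow_mul hCu,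
        show (2 : ℝ) * (3 / 2) = ((3 : ℕ) : ℝ) by norm_num, Real.rpow_natCast]
    have e3 : ((ρ ^ 3)⁻¹ : ℝ) = ρ ^ (-(3 : ℝ)) := by
      rw [Real.rpow_neg hρ0.le, show (3 : ℝ) = ((3 : ℕ) : ℝ) by norm_num, Real.rpow_natCast]
    have e2 : ENNReal.ofReal (ρ ^ (9 / 2 : ℝ)) * (ENNReal.ofReal (ρ ^ 3)⁻¹) ^ (3 / 2 : ℝ) = 1 := by
      rw [ENNReal.ofReal_rpow_of_nonneg (by positivity) (by norm_num),
        ← ENNReal.ofReal_mul (by positivity), ← ENNReal.ofReal_one]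
      congr 1
      rw [e3, ← Real.rpow_mul hρ0.le, ← Real.rpow_add hρ0]
      norm_num
    rw [hK₂, ENNReal.mul_rpow_of_nonneg _ _ (by norm_num : (0 : ℝ) ≤ 3 / 2),
      ENNReal.mul_rpow_of_nonneg _ _ (by norm_num : (0 : ℝ) ≤ 3 / 2), e1]
    calc ENNReal.ofReal C₂ * ENNReal.ofReal (ρ ^ (9 / 2 : ℝ)) *
          (ENNReal.ofReal (Cu ^ 3) * (G ^ (3 / 2 : ℝ) * (ENNReal.ofReal (ρ ^ 3)⁻¹) ^ (3 / 2 : ℝ)))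
        = ENNReal.ofReal C₂ * ENNReal.ofReal (Cu ^ 3) * G ^ (3 / 2 : ℝ) *
            (ENNReal.ofReal (ρ ^ (9 / 2 : ℝ)) * (ENNReal.ofReal (ρ ^ 3)⁻¹) ^ (3 / 2 : ℝ)) := by ring
      _ = _ := by rw [e2, mul_one]
  have hRt' : Rt = ENNReal.ofReal C₂ * ENNReal.ofReal ((64 * ρ) ^ (9 / 2 : ℝ)) := by
    rw [hRt]
    congr 2
    rw [← Real.div_rpow hρ0.le (by norm_num)]
    congr 1
    ring
  calc ∫⁻ w in parabolicCylinder ρ z, ‖p w.1 w.2 - ⨍ y' in B, p w.1 y'‖ₑ ^ (3 / 2 : ℝ)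
      ≤ (K₁ + K₂) * ENNReal.ofReal (ρ ^ 2) + Rt * (Bu + Bp) := hmain
    _ = _ := by
        rw [hK₁', hK₂', hRt']
        ring

end Decay

section Assembly

-- nested operator types
set_option maxSynthPendingDepth 3

/-- **Pineau–Vicol 2026, Lemma 9.2 for `k = 1`, near the vertex and at small scales, with a
constant depending only on `C_u`** (the tree's rendering; see the module docstring for the
deviation from the printed pressure-free argument). Given the constants of the local pressure
estimate and of the far-field weight: for every `C_u` there is `K = K(C_u)` such that for all
finite bounds `B_u`, `B_p` there is a scale `c₁ = c₁(C_u, B_u, B_p) > 0` with the property: every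
classical solution `(u, p)` on `[−1,0) × B₁` with the Type I bound (1.15),
`∫∫_{(−1,0)×B₁} |u|³ ≤ B_u` and `∫∫_{(−1,0)×B_{1/32}} |p|^{3/2} ≤ B_p` satisfies
`|∇u(x, t)| ≤ K (|x| + √(−t))⁻²` whenever `−1 < t < 0` and `|x| + √(−t) ≤ c₁`. Proof: with
`ρ = (|x| + √(−t))/8`, `|u| ≤ C_u/ρ` on `Q((t,x), 2ρ)` (Lemma 9.2's geometry), the mean-free
pressure on `Q((t,x), ρ)` has `∫∫ |p − (p)_ρ|^{3/2} ≤ ρ² (P₁(C_u) + 1)` once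
`C₂ (64ρ)^{9/2} (B_u + B_p) ≤ ρ²` (`lintegral_pressure_osc_le`), so the quantitative Serrin bound
(`exists_forall_fderiv_le_of_bounded`) gives `|∇u| ≤ K₀/ρ²` on `Q((t,x), ρ/2)`, and at `(x, t)`
itself by continuity of `∇u`. [cite: PineauVicol2026, Lemma 9.2 and its proof, arXiv:2607.09619 p. 30] -/
theorem exists_forall_fderiv_le_of_typeI {C₂ : ℝ}
    (hRRS : ∀ (z : ℝ × (EuclideanSpace ℝ (Fin 3))) (ρ : ℝ) (u : ℝ → (EuclideanSpace ℝ (Fin 3)) → (EuclideanSpace ℝ (Fin 3))) (p : ℝ → (EuclideanSpace ℝ (Fin 3)) → ℝ), 0 < ρ →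
      AEStronglyMeasurable (uncurry u) (volume.restrict (parabolicCylinder ρ z)) →
      AEStronglyMeasurable (uncurry p) (volume.restrict (parabolicCylinder ρ z)) →
      ∫⁻ w in parabolicCylinder ρ z, ‖u w.1 w.2‖ₑ ^ (3 : ℕ) < ∞ →
      ∫⁻ w in parabolicCylinder ρ z, ‖p w.1 w.2‖ₑ ^ (3 / 2 : ℝ) < ∞ →
      (∀ φ : ℝ → (EuclideanSpace ℝ (Fin 3)) → ℝ, IsSpaceTimeTestOn (parabolicCylinderOpens ρ z) φ →
        ∫ w in parabolicCylinder ρ z,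
          (⟪u w.1 w.2, convect (u w.1) (gradient (φ w.1)) w.2⟫ + p w.1 w.2 * Δ (φ w.1) w.2) = 0) →
      ∀ r : ℝ, 0 < r → r ≤ ρ / 2 →
        ∀ᵐ t ∂(volume.restrict (Ioo (z.1 - ρ ^ 2) z.1)),
          ∫⁻ x in ball z.2 r, ‖p t x - ⨍ y in ball z.2 r, p t y‖ₑ ^ (3 / 2 : ℝ) ≤
            ENNReal.ofReal C₂ * (∫⁻ x in ball z.2 (2 * r), ‖u t x‖ₑ ^ (3 : ℕ)) +
            ENNReal.ofReal C₂ * ENNReal.ofReal (r ^ (9 / 2 : ℝ)) *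
              (∫⁻ y in {y : (EuclideanSpace ℝ (Fin 3)) | 2 * r < dist y z.2 ∧ dist y z.2 < ρ},
                ‖u t y‖ₑ ^ 2 / ENNReal.ofReal (dist y z.2 ^ 4)) ^ (3 / 2 : ℝ) +
            ENNReal.ofReal C₂ * ENNReal.ofReal (r ^ (9 / 2 : ℝ) / ρ ^ (9 / 2 : ℝ)) *
              ∫⁻ x in ball z.2 ρ, (‖u t x‖ₑ ^ (3 : ℕ) + ‖p t x‖ₑ ^ (3 / 2 : ℝ)))
    {G : ℝ≥0∞} (hGtop : G < ⊤)
    (hG : ∀ (x : (EuclideanSpace ℝ (Fin 3))) (c : ℝ), 0 < c →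
      ∫⁻ y in {y : (EuclideanSpace ℝ (Fin 3)) | 2 * c < ‖y - x‖},
        ENNReal.ofReal (‖y‖ ^ (-(2 : ℝ))) * ENNReal.ofReal (‖y - x‖ ^ (-(4 : ℝ))) ≤
          G * ENNReal.ofReal (c ^ 3)⁻¹)
    (Cu : ℝ) :
    ∃ K : ℝ, 0 ≤ K ∧ ∀ (Bu Bp : ℝ≥0∞), Bu < ⊤ → Bp < ⊤ → ∃ c₁ : ℝ, 0 < c₁ ∧
      ∀ (u : ℝ → (EuclideanSpace ℝ (Fin 3)) → (EuclideanSpace ℝ (Fin 3))) (p : ℝ → (EuclideanSpace ℝ (Fin 3)) → ℝ),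
        IsClassicalNSSolutionOnRegion (Ico (-1 : ℝ) 0 ×ˢ ball (0 : (EuclideanSpace ℝ (Fin 3))) 1) 1 0 u p →
        (∀ t ∈ Ico (-1 : ℝ) 0, ∀ x ∈ ball (0 : (EuclideanSpace ℝ (Fin 3))) 1, ‖u t x‖ ≤ Cu / (Real.sqrt (-t) + ‖x‖)) →
        (∫⁻ w in Ioo (-1 : ℝ) 0 ×ˢ ball (0 : (EuclideanSpace ℝ (Fin 3))) 1, ‖u w.1 w.2‖ₑ ^ (3 : ℕ) ≤ Bu) →
        (∫⁻ w in Ioo (-1 : ℝ) 0 ×ˢ ball (0 : (EuclideanSpace ℝ (Fin 3))) (1 / 32), ‖p w.1 w.2‖ₑ ^ (3 / 2 : ℝ) ≤ Bp) →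
        ∀ t ∈ Ioo (-1 : ℝ) 0, ∀ x : (EuclideanSpace ℝ (Fin 3)), ‖x‖ + Real.sqrt (-t) ≤ c₁ →
          ‖fderiv ℝ (u t) x‖ ≤ K / (‖x‖ + Real.sqrt (-t)) ^ 2 := by
  -- the pressure bound `P₀ = P₀(C_u)` fed into the Serrin estimate
  set V₁ : ℝ≥0∞ := volume (ball (0 : (EuclideanSpace ℝ (Fin 3))) 1) with hV₁
  have hV₁top : V₁ ≠ ⊤ := measure_ball_lt_top.ne
  set P₁ : ℝ≥0∞ := ENNReal.ofReal C₂ * ENNReal.ofReal (Cu ^ 3) * (8 * V₁ + G ^ (3 / 2 : ℝ))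
    with hP₁
  have hP₁top : P₁ ≠ ⊤ := by
    refine ENNReal.mul_ne_top (ENNReal.mul_ne_top ENNReal.ofReal_ne_top ENNReal.ofReal_ne_top)
      (ENNReal.add_ne_top.2 ⟨ENNReal.mul_ne_top (by norm_num) hV₁top,
        ENNReal.rpow_ne_top_of_nonneg (by norm_num) hGtop.ne⟩)
  set P₀ : ℝ≥0 := (P₁ + 1).toNNReal with hP₀
  have hP₀eq : (P₀ : ℝ≥0∞) = P₁ + 1 := by
    rw [hP₀, ENNReal.coe_toNNReal (ENNReal.add_ne_top.2 ⟨hP₁top, ENNReal.one_ne_top⟩)]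
  obtain ⟨K₀, hK₀0, hSer⟩ := exists_forall_fderiv_le_of_bounded Cu P₀
  refine ⟨64 * K₀, by positivity, fun Bu Bp hBut hBpt => ?_⟩
  -- the smallness scale
  set W : ℝ := (ENNReal.ofReal C₂ * ENNReal.ofReal ((64 : ℝ) ^ (9 / 2 : ℝ)) * (Bu + Bp)).toReal
    with hW
  have hW0 : 0 ≤ W := ENNReal.toReal_nonneg
  set ρ₁ : ℝ := (W + 1) ^ (-(2 / 5 : ℝ)) with hρ₁
  have hρ₁0 : 0 < ρ₁ := Real.rpow_pos_of_pos (by linarith) _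
  refine ⟨min (1 / 64) (8 * ρ₁), lt_min (by norm_num) (by positivity), ?_⟩
  intro u p hreg hI hBu hBp t ht x hxt
  have hsmall : ‖x‖ + Real.sqrt (-t) ≤ 1 / 64 := hxt.trans (min_le_left _ _)
  have hsmall' : ‖x‖ + Real.sqrt (-t) ≤ 8 * ρ₁ := hxt.trans (min_le_right _ _)
  -- geometry (as in `lintegral_pressure_osc_le`)
  set m : ℝ := min ((1 / 2 : ℝ) / 4) (1 / 6) with hm_def
  have hm : m = 1 / 8 := by rw [hm_def]; norm_num
  set ρ : ℝ := m * (‖x‖ + Real.sqrt (-t)) with hρ_def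
  have ht0 : t < 0 := ht.2
  have hsq : 0 < Real.sqrt (-t) := Real.sqrt_pos.2 (by linarith)
  have hρ0 : 0 < ρ := pineauVicol_lemma92_radius_pos (x := x) (ε := 1 / 2) (by norm_num) ht0
  have hρle : ρ ≤ 1 / 512 := by rw [hρ_def, hm]; linarith
  have hρρ₁ : ρ ≤ ρ₁ := by rw [hρ_def, hm]; linarith
  have hx : ‖x‖ < 1 - 1 / 2 := by linarith [hsq.le, norm_nonneg x]
  have ht1 : -(1 - 1 / 2 : ℝ) ^ 2 < t := by
    have h1 : Real.sqrt (-t) ≤ 1 / 64 := by linarith [norm_nonneg x]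
    have h2 : -t ≤ (1 / 64) ^ 2 := by
      have := Real.sq_sqrt (by linarith : (0 : ℝ) ≤ -t)
      nlinarith [Real.sqrt_nonneg (-t)]
    nlinarith
  have hCu : 0 ≤ Cu := by
    have h := hI (-(1 / 2 : ℝ)) ⟨by norm_num, by norm_num⟩ 0 (mem_ball_self one_pos)
    rw [norm_zero, add_zero] at h
    have hs : 0 < Real.sqrt (-(-(1 / 2 : ℝ))) := Real.sqrt_pos.2 (by norm_num)
    have h0 : 0 ≤ Cu / Real.sqrt (-(-(1 / 2 : ℝ))) := (norm_nonneg _).trans h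
    exact (div_nonneg_iff.1 h0).elim (fun h => h.1) fun h => absurd h.2 (not_le.2 hs)
  set z : ℝ × (EuclideanSpace ℝ (Fin 3)) := (t, x) with hz_def
  -- comparison of radii (`ρ` versus the `2ρ` of Lemma 9.2's geometry lemmas)
  have hA : ∀ d : ℝ, d ≤ ρ → d < 2 * (min ((1 / 2 : ℝ) / 4) (1 / 6) * (‖x‖ + Real.sqrt (-t))) :=
    fun d hd => by
      show d < 2 * ρ
      linarith
  have hB : ∀ s : ℝ, t - ρ ^ 2 ≤ s →
      t - (2 * (min ((1 / 2 : ℝ) / 4) (1 / 6) * (‖x‖ + Real.sqrt (-t)))) ^ 2 < s :=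
    fun s hs => by
      show t - (2 * ρ) ^ 2 < s
      nlinarith
  -- the small cylinder lies in the open region
  have hO : IsOpen (Ioo (-1 : ℝ) 0 ×ˢ ball (0 : (EuclideanSpace ℝ (Fin 3))) 1) := isOpen_Ioo.prod isOpen_ball
  have hreg' := hreg.mono_of_isOpen (prod_mono Ioo_subset_Ico_self Subset.rfl) hO
  have hQsub : parabolicCylinder ρ z ⊆ Ioo (-1 : ℝ) 0 ×ˢ ball (0 : (EuclideanSpace ℝ (Fin 3))) 1 := by
    intro w hw
    rw [mem_parabolicCylinder] at hw
    obtain ⟨⟨h1, h2⟩, h3⟩ := hw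
    simp only [hz_def] at h1 h2 h3
    obtain ⟨h4, h5, h6⟩ := pineauVicol_lemma92_cylinder_subset (ε := 1 / 2) (by norm_num) (by norm_num)
      hx ht1 ht0 (x' := w.2) (t' := w.1) (hA _ h3.le) (hB _ h1.le) h2.le
    exact mk_mem_prod ⟨h4, h5⟩ h6
  have hregQ : IsClassicalNSSolutionOnRegion (parabolicCylinder ρ z) 1 0 u p :=
    hreg'.mono_of_isOpen hQsub (isOpen_parabolicCylinder ρ z)
  -- the velocity bound `|u| ≤ C_u/ρ` on `Q(z, ρ)`
  have hbd : ∀ w ∈ parabolicCylinder ρ z, ‖u w.1 w.2‖ ≤ Cu / ρ := by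
    intro w hw
    rw [mem_parabolicCylinder] at hw
    obtain ⟨⟨h1, h2⟩, h3⟩ := hw
    simp only [hz_def] at h1 h2 h3
    exact pineauVicol_lemma92_velocity_bound (ε := 1 / 2) hCu hI (by norm_num) (by norm_num)
      hx ht1 ht0 (hA _ h3.le) (hB _ h1.le) h2.le
  -- the mean-free pressure bound
  have hosc := lintegral_pressure_osc_le hRRS hG hreg hI hBut hBpt hBu hBp ht hsmall
  have htail : ENNReal.ofReal C₂ * ENNReal.ofReal ((64 * ρ) ^ (9 / 2 : ℝ)) * (Bu + Bp) ≤
      ENNReal.ofReal (ρ ^ 2) := by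
    -- `C₂ (64ρ)^{9/2} (Bu + Bp) = ρ^{9/2} W ≤ ρ²` iff `ρ^{5/2} W ≤ 1`
    have hWtop : ENNReal.ofReal C₂ * ENNReal.ofReal ((64 : ℝ) ^ (9 / 2 : ℝ)) * (Bu + Bp) ≠ ⊤ :=
      ENNReal.mul_ne_top (ENNReal.mul_ne_top ENNReal.ofReal_ne_top ENNReal.ofReal_ne_top)
        (ENNReal.add_ne_top.2 ⟨hBut.ne, hBpt.ne⟩)
    have e1 : ENNReal.ofReal C₂ * ENNReal.ofReal ((64 * ρ) ^ (9 / 2 : ℝ)) * (Bu + Bp) =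
        ENNReal.ofReal (ρ ^ (9 / 2 : ℝ)) * ENNReal.ofReal W := by
      rw [hW, ENNReal.ofReal_toReal hWtop, Real.mul_rpow (by norm_num) hρ0.le,
        ENNReal.ofReal_mul (by positivity)]
      ring
    rw [e1, ← ENNReal.ofReal_mul (by positivity)]
    refine ENNReal.ofReal_le_ofReal ?_
    -- `ρ^{9/2} W ≤ ρ²`
    have hρ52 : ρ ^ (9 / 2 : ℝ) = ρ ^ 2 * ρ ^ (5 / 2 : ℝ) := by
      rw [show (9 / 2 : ℝ) = 2 + 5 / 2 by norm_num, Real.rpow_add hρ0,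
        show (2 : ℝ) = ((2 : ℕ) : ℝ) by norm_num, Real.rpow_natCast]
    have hρW : ρ ^ (5 / 2 : ℝ) * W ≤ 1 := by
      have h1 : ρ ^ (5 / 2 : ℝ) ≤ ρ₁ ^ (5 / 2 : ℝ) := Real.rpow_le_rpow hρ0.le hρρ₁ (by norm_num)
      have h2 : ρ₁ ^ (5 / 2 : ℝ) = (W + 1)⁻¹ := by
        rw [hρ₁, ← Real.rpow_mul (by linarith)]
        norm_num
        rw [Real.rpow_neg_one]
      calc ρ ^ (5 / 2 : ℝ) * W ≤ (W + 1)⁻¹ * W := by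
            rw [← h2]; exact mul_le_mul_of_nonneg_right h1 hW0
        _ ≤ (W + 1)⁻¹ * (W + 1) := by gcongr; linarith
        _ = 1 := inv_mul_cancel₀ (by linarith)
    calc ρ ^ (9 / 2 : ℝ) * W = ρ ^ 2 * (ρ ^ (5 / 2 : ℝ) * W) := by rw [hρ52]; ring
      _ ≤ ρ ^ 2 * 1 := by gcongr
      _ = ρ ^ 2 := mul_one _
  have hPbound : ∫⁻ w in parabolicCylinder ρ z,
      ‖p w.1 w.2 - ⨍ y in ball x ρ, p w.1 y‖ₑ ^ (3 / 2 : ℝ) ≤ ENNReal.ofReal (ρ ^ 2) * P₀ := by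
    have e : ENNReal.ofReal (ρ ^ 2) * (P₀ : ℝ≥0∞) =
        ENNReal.ofReal (ρ ^ 2) * P₁ + ENNReal.ofReal (ρ ^ 2) := by
      rw [hP₀eq, mul_add, mul_one]
    rw [e]
    exact hosc.trans (add_le_add le_rfl htail)
  -- local integrability of the mean (bounded and a.e. strongly measurable on the cylinder)
  have hQbig : parabolicCylinder ρ z ⊆ Ioo (-1 : ℝ) 0 ×ˢ ball (0 : (EuclideanSpace ℝ (Fin 3))) 1 := hQsub
  have hpc : ContinuousOn (uncurry p) (parabolicCylinder ρ z) :=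
    hreg'.smooth_pressure.continuousOn.mono hQbig
  have hprod : (volume : Measure (ℝ × (EuclideanSpace ℝ (Fin 3)))).restrict (parabolicCylinder ρ z) =
      (volume.restrict (Ioo (t - ρ ^ 2) t)).prod (volume.restrict (ball x ρ)) := by
    rw [RRS2016.volume_restrict_parabolicCylinder ρ z]
  have hpQ : AEStronglyMeasurable (uncurry p)
      ((volume.restrict (Ioo (t - ρ ^ 2) t)).prod (volume.restrict (ball x ρ))) := by
    rw [← hprod]
    exact hpc.aestronglyMeasurable (isOpen_parabolicCylinder ρ z).measurableSet
  have hmean : AEStronglyMeasurable (fun t' => ⨍ y in ball x ρ, p t' y)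
      (volume.restrict (Ioo (t - ρ ^ 2) t)) := by
    have h1 := hpQ.integral_prod_right'
    have e : (fun t' => ⨍ y in ball x ρ, p t' y) =
        fun t' => (volume.real (ball x ρ))⁻¹ • ∫ y, p t' y ∂(volume.restrict (ball x ρ)) := by
      funext t'
      rw [setAverage_eq]
    rw [e]
    exact h1.const_smul ((volume.real (ball x ρ))⁻¹ : ℝ)
  -- the mean is bounded: `p` is continuous on the compact closure `[t-ρ², t] × B̄(x, ρ)`
  have hKc : IsCompact (Icc (t - ρ ^ 2) t ×ˢ closedBall x ρ) :=
    isCompact_Icc.prod (isCompact_closedBall x ρ)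
  have hKsub : Icc (t - ρ ^ 2) t ×ˢ closedBall x ρ ⊆ Ioo (-1 : ℝ) 0 ×ˢ ball (0 : (EuclideanSpace ℝ (Fin 3))) 1 := by
    intro w hw
    obtain ⟨⟨h1, h2⟩, h3⟩ := hw
    rw [mem_closedBall] at h3
    obtain ⟨h4, h5, h6⟩ := pineauVicol_lemma92_cylinder_subset (ε := 1 / 2) (by norm_num) (by norm_num)
      hx ht1 ht0 (x' := w.2) (t' := w.1) (hA _ h3) (hB _ h1) h2
    exact mk_mem_prod ⟨h4, lt_of_le_of_lt h2 ht0⟩ h6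
  obtain ⟨M, hM⟩ := hKc.exists_bound_of_continuousOn
    (hreg'.smooth_pressure.continuousOn.mono hKsub)
  have hmeanbd : ∀ t' ∈ Ioo (t - ρ ^ 2) t, ‖⨍ y in ball x ρ, p t' y‖ ≤ M := by
    intro t' ht'
    rw [setAverage_eq, norm_smul, norm_inv, Real.norm_of_nonneg measureReal_nonneg]
    have hvol : 0 < volume.real (ball x ρ) := by
      rw [measureReal_def]
      exact ENNReal.toReal_pos (measure_ball_pos volume x hρ0).ne' measure_ball_lt_top.ne
    have hint : ‖∫ y in ball x ρ, p t' y‖ ≤ M * volume.real (ball x ρ) := by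
      refine norm_setIntegral_le_of_norm_le_const measure_ball_lt_top fun y hy => ?_
      exact hM (t', y) (mk_mem_prod ⟨ht'.1.le, ht'.2.le⟩ (ball_subset_closedBall hy))
    calc (volume.real (ball x ρ))⁻¹ * ‖∫ y in ball x ρ, p t' y‖
        ≤ (volume.real (ball x ρ))⁻¹ * (M * volume.real (ball x ρ)) := by gcongr
      _ = M := by field_simp
  have hloc : LocallyIntegrableOn (fun w : ℝ × (EuclideanSpace ℝ (Fin 3)) => ⨍ y in ball x ρ, p w.1 y)
      (parabolicCylinder ρ z) volume := by
    refine IntegrableOn.locallyIntegrableOn ?_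
    have hvolQ : volume (parabolicCylinder ρ z) < ⊤ := by
      rw [show parabolicCylinder ρ z = Ioo (t - ρ ^ 2) t ×ˢ ball x ρ by rfl, Measure.volume_eq_prod,
        Measure.prod_prod]
      exact ENNReal.mul_lt_top (by simp) measure_ball_lt_top
    refine IntegrableOn.of_bound hvolQ ?_ M ?_
    · rw [hprod]
      exact hmean.comp_fst
    · rw [ae_restrict_iff' (isOpen_parabolicCylinder ρ z).measurableSet]
      filter_upwards with w hw
      rw [mem_parabolicCylinder] at hw
      have hw1 : t - ρ ^ 2 < w.1 ∧ w.1 < t := by simpa only [hz_def] using hw.1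
      exact hmeanbd w.1 hw1
  -- the Serrin bound on `Q(z, ρ/2)`
  have hgrad := hSer u p (fun t' => ⨍ y in ball x ρ, p t' y) z ρ hρ0 hregQ hbd hloc hPbound
  -- pass to the vertex `(x, t)` by continuity of `∇u`
  have hcont : ContinuousOn (fun w : ℝ × (EuclideanSpace ℝ (Fin 3)) => fderiv ℝ (u w.1) w.2) (Ioo (-1 : ℝ) 0 ×ˢ ball (0 : (EuclideanSpace ℝ (Fin 3))) 1) :=
    continuousOn_fderiv_slice_of_isOpen hO hreg'.smooth_velocity (by exact_mod_cast le_top)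
  have hxball : x ∈ ball (0 : (EuclideanSpace ℝ (Fin 3))) 1 := by
    rw [mem_ball_zero_iff]; linarith [hsq.le]
  have htx : (t, x) ∈ Ioo (-1 : ℝ) 0 ×ˢ ball (0 : (EuclideanSpace ℝ (Fin 3))) 1 := mk_mem_prod ht hxball
  have hlim : Tendsto (fun s : ℝ => fderiv ℝ (u s) x) (𝓝[<] t) (𝓝 (fderiv ℝ (u t) x)) := by
    have h1 : ContinuousWithinAt (fun w : ℝ × (EuclideanSpace ℝ (Fin 3)) => fderiv ℝ (u w.1) w.2)
        (Ioo (-1 : ℝ) 0 ×ˢ ball (0 : (EuclideanSpace ℝ (Fin 3))) 1) (t, x) := hcont (t, x) htx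
    have h2 : Tendsto (fun s : ℝ => ((s, x) : ℝ × (EuclideanSpace ℝ (Fin 3)))) (𝓝[<] t)
        (𝓝[Ioo (-1 : ℝ) 0 ×ˢ ball (0 : (EuclideanSpace ℝ (Fin 3))) 1] (t, x)) := by
      refine tendsto_nhdsWithin_of_tendsto_nhds_of_eventually_within _ ?_ ?_
      · exact ((continuous_id.prodMk continuous_const).tendsto t).mono_left nhdsWithin_le_nhds
      · have : ∀ᶠ s in 𝓝[<] t, s ∈ Ioo (-1 : ℝ) t :=
          Ioo_mem_nhdsLT ht.1
        filter_upwards [this] with s hs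
        exact mk_mem_prod ⟨hs.1, lt_trans hs.2 ht0⟩ hxball
    exact h1.tendsto.comp h2
  have hev : ∀ᶠ s in 𝓝[<] t, ‖fderiv ℝ (u s) x‖ ≤ K₀ / ρ ^ 2 := by
    have : ∀ᶠ s in 𝓝[<] t, s ∈ Ioo (t - (ρ / 2) ^ 2) t :=
      Ioo_mem_nhdsLT (by nlinarith)
    filter_upwards [this] with s hs
    have hmem : ((s, x) : ℝ × (EuclideanSpace ℝ (Fin 3))) ∈ parabolicCylinder (ρ / 2) z := by
      rw [mem_parabolicCylinder]
      simp only [hz_def, dist_self]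
      exact ⟨hs, by positivity⟩
    exact hgrad (s, x) hmem
  have hle : ‖fderiv ℝ (u t) x‖ ≤ K₀ / ρ ^ 2 :=
    le_of_tendsto (hlim.norm) hev
  calc ‖fderiv ℝ (u t) x‖ ≤ K₀ / ρ ^ 2 := hle
    _ = 64 * K₀ / (‖x‖ + Real.sqrt (-t)) ^ 2 := by
        rw [hρ_def, hm]
        field_simp
        ring

/-- **Lemma 9.2 (`k = 1`) near the vertex, with the constants of the tree instantiated**: for
every `C_u` there is `K = K(C_u)` and, for all finite `B_u`, `B_p`, a scale `c₁ > 0` such that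
every classical solution on `[−1,0) × B₁` with (1.15), `∫∫_{(−1,0)×B₁} |u|³ ≤ B_u` and
`∫∫_{(−1,0)×B_{1/32}} |p|^{3/2} ≤ B_p` has `|∇u(x,t)| ≤ K (|x| + √(−t))⁻²` for `−1 < t < 0`,
`|x| + √(−t) ≤ c₁` (`exists_forall_fderiv_le_of_typeI` with `RRS2016.lemma15_12_holds` and
`exists_farField_bound`). Under (1.15)–(1.16) both `B_u = B_u(C_u)` and `B_p = B_p(C_u, C_p)`
are available (`PineauVicolOneSlicePressure`), so `c₁ = c₁(C_u, C_p)` — the dependence allowed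
for `s₀` in Theorem 1.9 — while `K` depends on `C_u` only, as required for `δ₀`.
[cite: PineauVicol2026, Lemma 9.2, arXiv:2607.09619 p. 30] -/
theorem exists_forall_fderiv_le_of_typeI_of_bounds (Cu : ℝ) :
    ∃ K : ℝ, 0 ≤ K ∧ ∀ (Bu Bp : ℝ≥0∞), Bu < ⊤ → Bp < ⊤ → ∃ c₁ : ℝ, 0 < c₁ ∧
      ∀ (u : ℝ → (EuclideanSpace ℝ (Fin 3)) → (EuclideanSpace ℝ (Fin 3))) (p : ℝ → (EuclideanSpace ℝ (Fin 3)) → ℝ),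
        IsClassicalNSSolutionOnRegion (Ico (-1 : ℝ) 0 ×ˢ ball (0 : (EuclideanSpace ℝ (Fin 3))) 1) 1 0 u p →
        (∀ t ∈ Ico (-1 : ℝ) 0, ∀ x ∈ ball (0 : (EuclideanSpace ℝ (Fin 3))) 1, ‖u t x‖ ≤ Cu / (Real.sqrt (-t) + ‖x‖)) →
        (∫⁻ w in Ioo (-1 : ℝ) 0 ×ˢ ball (0 : (EuclideanSpace ℝ (Fin 3))) 1, ‖u w.1 w.2‖ₑ ^ (3 : ℕ) ≤ Bu) →
        (∫⁻ w in Ioo (-1 : ℝ) 0 ×ˢ ball (0 : (EuclideanSpace ℝ (Fin 3))) (1 / 32), ‖p w.1 w.2‖ₑ ^ (3 / 2 : ℝ) ≤ Bp) →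
        ∀ t ∈ Ioo (-1 : ℝ) 0, ∀ x : (EuclideanSpace ℝ (Fin 3)), ‖x‖ + Real.sqrt (-t) ≤ c₁ →
          ‖fderiv ℝ (u t) x‖ ≤ K / (‖x‖ + Real.sqrt (-t)) ^ 2 := by
  obtain ⟨C₂, -, hRRS⟩ := RRS2016.lemma15_12_holds
  obtain ⟨G, hGtop, hG⟩ := exists_farField_bound
  exact exists_forall_fderiv_le_of_typeI hRRS hGtop hG Cu

end Assembly

end Literature.Analysis.FluidPDE

end
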